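import Literature.MathematicalPhysics.QuantumLattice.ProjectedEntangledPairStatesGaugeProofs
import HarnessLib

/-!
# `G`-injective PEPS: the ground space of the parent Hamiltonian (Schuch–Cirac–Pérez-García, Thm. 5.7)

Sibling proof file of `Literature/MathematicalPhysics/QuantumLattice/ProjectedEntangledPairStates.lean`,
building on `ProjectedEntangledPairStatesGroundStateProofs.lean` (the injective case: leg
coordinates, `𝒫^{⊗R}`, `T^{⊗R}`, block slices, the spaces `V_S`) and
`ProjectedEntangledPairStatesGaugeProofs.lean` (the leg representation `ρ(U)`, the `G`-injective
left inverse `T 𝒫 = Π_𝒰`, gauge invariance of `𝒫^{⊗Λ}`). Theorems only: no statement or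
definition is changed and no definition is introduced. It discharges the named fact

* `Literature.MathematicalPhysics.QuantumLattice.pepsParent_groundSpace_of_GInjective` — *for a
  semi-regular unitary representation `U` of a finite group `G` (`IsSemiregularRep U`), a
  `G`-injective PEPS tensor `A` (`IsGInjectivePEPS U 1 1 A`) and `2 ≤ L`, the zero-energy space of
  the parent Hamiltonian `H = Σ_{x ∈ (ℤ/L)²} (1 - Π_{𝒮_{2×2}})_x` on the `L × L` torus is the span
  of the `(g,h)`-closed PEPS `|Ψ(A | (g,h))⟩ = pepsTorusTwisted L A U_g U_h` with `gh = hg`*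

as `pepsParent_groundSpace_of_GInjective_holds`.

## Source and the architecture of the proof

N. Schuch, I. Cirac, D. Pérez-García, *PEPS as ground states: degeneracy and topology*, Ann. Phys.
**325** (2010) 2153–2192, arXiv:1001.3807 (held: `paper:arxiv-1001.3807`), §5: Def. 5.1
(`G`-injectivity), Lemma 5.2 (stability under blocking), **Thm. 5.4** (intersection), **Thm. 5.5**
(closure: the intersection of the four open `L × L` regions is spanned by the `(g,h)`-closures,
`gh = hg`), Def. 5.6, **Thm. 5.7** (parent Hamiltonian), and the discussion after Thm. 5.9
(eq. (34): strings of `U_g`'s can be deformed freely by the `G`-invariance; the two loops can be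
moved anywhere iff `g` and `h` commute). The printed proofs consist in applying the left inverse
of `𝒫(A)` to the physical legs and comparing the resulting virtual tensors, which after the
`G`-injective left inverse carry the averaging projectors `Π_𝒰` and hence sums over gauge group
elements (eqs. (27), (35), (36)).

We formalize this at the **virtual level of the whole torus**, where the bookkeeping of Thms.
5.4/5.5 becomes lattice gauge theory with gauge group `G^Λ`:

1. *The `2 × 2` block under the blockwise gauge average* (`sum_legRep_block_matched`): applying
   `⊗_p ρ(U_{γ_p})` to the block tensor `δ_inner X` yields the pure gauge `U_{γ_s} U_{γ_t}†` on the
   four inner bonds — this is the content of Lemma 5.2 / Thm. 5.4 ("the action of `U_g` on the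
   inner link cancels").
2. *Local gauge form* (`virtualT_localGaugeForm`): for a zero-energy vector `ψ`, the virtual tensor
   `Φ = T^{⊗Λ} ψ` is at every plaquette a combination of pure-gauge (hence **flat**) bond tensors
   `⊗_{(i,c)} U_{κ(i,c)}` with coefficients independent of the legs of that plaquette
   (`T^{⊗4} 𝒫^{⊗4} = Π_𝒰^{⊗4} = |G|⁻⁴ Σ_γ ⊗_p ρ(U_{γ_p})`, `virtualT_eq_sum_offBlock_gen`).
3. *Expansion in flat bond tensors* (`virtualT_bondExpansion`): semi-regularity gives dual
   functionals `d_k` to the `U_k` (`exists_dual_of_isSemiregularRep`, Lemma 4.6); the bond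
   projections `Σ_k U_k ⊗ d_k` fix `Φ` bond by bond, so `Φ = Σ_κ c_κ ⊗_b U_{κ_b}` over
   configurations `κ : bonds → G`, and duality kills every `κ` that is not flat on every plaquette
   (`bondExp_expand`, `bondExp_coeff_eq_zero`). This replaces "`T^{⊗Λ} ψ ∈ V_{all bonds}`" of the
   injective case.
4. *Discrete holonomy* (`exists_gauge_of_flat`, the combinatorial core of Thm. 5.5): a flat
   configuration on the torus is a gauge transform of a closure configuration `ω_{g,h}` (`g` on the
   horizontal bonds leaving column `-1`, `h` on the vertical bonds leaving row `-1`) with `gh = hg`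
   — the two holonomies commute because transport around the torus can be taken rows-first or
   columns-first.
5. *Gauge invariance* (`virtualP_gauge`, `gauge_bondTensor`): `𝒫^{⊗Λ}` of a gauge-transformed bond
   tensor is `𝒫^{⊗Λ}` of the bond tensor, and `𝒫^{⊗Λ}(Ω_{U_g,U_h}) = pepsTorusTwisted L A U_g U_h`
   (`pepsTorusTwisted_eq_sum_legs`). With `ψ = 𝒫^{⊗Λ} T^{⊗Λ} ψ` (`π = 𝒫 T` fixes `ψ` sitewise)
   this proves "⊆"; "⊇" (`pepsParentHamiltonian_mulVec_pepsTorusTwisted`) moves both loops off any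
   given block by an explicit gauge transformation (`closureGauge_trivial_on_block`, using `gh = hg`)
   and invokes the block-state slices of `𝒫^{⊗Λ}(V_{S_x})` from the injective file.

`2 ≤ L` enters through the injectivity of the anchor map of a `2 × 2` block; `L = 2` is allowed.
Degenerate `q = 0`: the Hilbert space is `0`.

## References

* N. Schuch, I. Cirac, D. Pérez-García, *PEPS as ground states: degeneracy and topology*,
  Ann. Phys. **325** (2010) 2153–2192, doi:10.1016/j.aop.2010.05.008, arXiv:1001.3807: Def. 4.5,
  Lemma 4.6, Def. 5.1, Lemma 5.2, §5.2 Thm. 5.4, Thm. 5.5, Def. 5.6, Thm. 5.7, eq. (34).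
  [SchuchCiracPerezGarcia2010]
* D. Pérez-García, F. Verstraete, M. M. Wolf, J. I. Cirac, *PEPS as unique ground states of local
  Hamiltonians*, Quantum Inf. Comput. **8** (2008) 650–663, arXiv:0707.2260, §4 Lemma 2 (the
  intersection lemma for three regions). [PerezGarciaVerstraeteWolfCirac2008PEPS]
-/

noncomputable section

open Matrix Complex Finset
open scoped ComplexOrder

namespace Literature.MathematicalPhysics.QuantumLattice

open Literature.Probability.LatticeModels

section QLattice

variable {q D : ℕ}

/-! ### The `2 × 2` block under a blockwise gauge average: local gauge form -/

/-- **Gauge action on the `2 × 2` block tensor `δ_inner X`.** For site-dependent matrices `U_p`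
on the four sites of the abstract `2 × 2` block, `(⊗_p ρ(U_p)) (δ_inner · X)(G)` equals the product
over the four inner bonds `(s → t)` of `(U_s U_t†)(G_s^{out}, G_t^{in})` times the boundary tensor
`X` acted on by `Ū_p` / `U_p` on the outer legs: the inner `δ`'s turn into the bond matrices
`U_s U_t†` (a pure gauge), the outer legs carry the action to `X`. This is the computation behind
Schuch–Cirac–Pérez-García (2010) Lemma 5.2 / Thm. 5.4 ("the action of the `U_g` on the inner link
cancels" when `U_s = U_t`). [cite: SchuchCiracPerezGarcia2010, Lemma 5.2] -/
theorem sum_legRep_block_matched (Us : Fin 2 × Fin 2 → Matrix (Fin D) (Fin D) ℂ)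
    (GB : Fin 2 × Fin 2 → Fin 2 → Fin 2 → Fin D) (X : PEPSBoundary D 2 2) :
    ∑ G' : Fin 2 × Fin 2 → Fin 2 → Fin 2 → Fin D,
        (∏ p, (fun (g g' : Fin 2 → Fin 2 → Fin D) => ∏ i : Fin 2, ∏ s : Fin 2,
          (![fun a b => star ((Us p) a b), fun a b => (Us p) a b] : Fin 2 → Fin D → Fin D → ℂ) s
            (g i s) (g' i s)) (GB p) (G' p)) *
          (if (∀ b : Fin 2, G' (0, b) 0 1 = G' (1, b) 0 0) ∧ (∀ a : Fin 2, G' (a, 0) 1 1 = G' (a, 1) 1 0)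
            then X (fun b => G' (0, b) 0 0) (fun a => G' (a, 0) 1 0) (fun b => G' (1, b) 0 1)
              (fun a => G' (a, 1) 1 1) else 0) =
      (∏ i : Fin 2, ∏ c : Fin 2,
          (Us (![((0 : Fin 2), c), (c, 0)] i) * (Us (![((1 : Fin 2), c), (c, 1)] i))ᴴ)
            (GB (![((0 : Fin 2), c), (c, 0)] i) i 1) (GB (![((1 : Fin 2), c), (c, 1)] i) i 0)) *
        ∑ l : Fin 2 → Fin D, ∑ u : Fin 2 → Fin D, ∑ r : Fin 2 → Fin D, ∑ d : Fin 2 → Fin D,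
          (∏ b, star (Us (0, b) (GB (0, b) 0 0) (l b))) * (∏ a, star (Us (a, 0) (GB (a, 0) 1 0) (u a))) *
            (∏ b, Us (1, b) (GB (1, b) 0 1) (r b)) * (∏ a, Us (a, 1) (GB (a, 1) 1 1) (d a)) *
              X l u r d := by
  -- parametrisation of the inner-matched block configurations by (outer legs, inner bonds)
  let Ψ : ((Fin 2 → Fin D) × (Fin 2 → Fin D) × (Fin 2 → Fin D) × (Fin 2 → Fin D)) ×
      (Fin 2 → Fin 2 → Fin D) → Fin 2 × Fin 2 → Fin 2 → Fin 2 → Fin D :=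
    fun v p => ![![![v.1.1 p.2, v.2 0 p.2] p.1, ![v.2 0 p.2, v.1.2.2.1 p.2] p.1],
      ![![v.1.2.1 p.1, v.2 1 p.1] p.2, ![v.2 1 p.1, v.1.2.2.2 p.1] p.2]]
  let Λinv : (Fin 2 × Fin 2 → Fin 2 → Fin 2 → Fin D) →
      ((Fin 2 → Fin D) × (Fin 2 → Fin D) × (Fin 2 → Fin D) × (Fin 2 → Fin D)) ×
        (Fin 2 → Fin 2 → Fin D) :=
    fun G' => ((fun b => G' (0, b) 0 0, fun a => G' (a, 0) 1 0, fun b => G' (1, b) 0 1,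
      fun a => G' (a, 1) 1 1), fun i => ![fun b => G' (0, b) 0 1, fun a => G' (a, 0) 1 1] i)
  have hleft : Function.LeftInverse Λinv Ψ := by
    rintro ⟨⟨l, u, r, d⟩, w⟩
    simp only [Ψ, Λinv, Prod.mk.injEq]
    refine ⟨⟨rfl, rfl, rfl, rfl⟩, ?_⟩
    funext i c
    fin_cases i <;> rfl
  have hΨ : Function.Injective Ψ := hleft.injective
  have himage : ∀ G' : Fin 2 × Fin 2 → Fin 2 → Fin 2 → Fin D,
      ((∀ b : Fin 2, G' (0, b) 0 1 = G' (1, b) 0 0) ∧ (∀ a : Fin 2, G' (a, 0) 1 1 = G' (a, 1) 1 0)) ↔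
        ∃ v, Ψ v = G' := by
    intro G'
    constructor
    · rintro ⟨hh, hv⟩
      refine ⟨Λinv G', ?_⟩
      funext ⟨a, b⟩ i s
      fin_cases a <;> fin_cases b <;> fin_cases i <;> fin_cases s <;> simp [Ψ, Λinv, hh, hv]
    · rintro ⟨⟨⟨l, u, r, d⟩, w⟩, rfl⟩
      exact ⟨fun b => rfl, fun a => rfl⟩
  -- move the weight inside the indicator and reparametrise
  have hite : ∀ (P : Prop) [Decidable P] (a b : ℂ),
      a * (if P then b else 0) = (if P then a * b else 0) := by
    intros
    split_ifs <;> simp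
  simp only [hite]
  rw [← sum_comp_eq_sum_ite_of_injective Ψ hΨ _ himage, Fintype.sum_prod_type]
  simp only [Fintype.sum_prod_type]
  -- pointwise factorisation of the sixteen leg factors into inner-bond and outer-leg parts
  have hpt : ∀ (l u r d : Fin 2 → Fin D) (w : Fin 2 → Fin 2 → Fin D),
      (∏ p, (fun (g g' : Fin 2 → Fin 2 → Fin D) => ∏ i : Fin 2, ∏ s : Fin 2,
          (![fun a b => star ((Us p) a b), fun a b => (Us p) a b] : Fin 2 → Fin D → Fin D → ℂ) s
            (g i s) (g' i s)) (GB p) (Ψ ((l, u, r, d), w) p)) *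
        X (fun b => Ψ ((l, u, r, d), w) (0, b) 0 0) (fun a => Ψ ((l, u, r, d), w) (a, 0) 1 0)
          (fun b => Ψ ((l, u, r, d), w) (1, b) 0 1) (fun a => Ψ ((l, u, r, d), w) (a, 1) 1 1) =
      (∏ i : Fin 2, ∏ c : Fin 2,
          Us (![((0 : Fin 2), c), (c, 0)] i) (GB (![((0 : Fin 2), c), (c, 0)] i) i 1) (w i c) *
            star (Us (![((1 : Fin 2), c), (c, 1)] i) (GB (![((1 : Fin 2), c), (c, 1)] i) i 0) (w i c))) *
        ((∏ b, star (Us (0, b) (GB (0, b) 0 0) (l b))) * (∏ a, star (Us (a, 0) (GB (a, 0) 1 0) (u a))) *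
            (∏ b, Us (1, b) (GB (1, b) 0 1) (r b)) * (∏ a, Us (a, 1) (GB (a, 1) 1 1) (d a)) *
              X l u r d) := by
    intro l u r d w
    have hX : X (fun b => Ψ ((l, u, r, d), w) (0, b) 0 0) (fun a => Ψ ((l, u, r, d), w) (a, 0) 1 0)
        (fun b => Ψ ((l, u, r, d), w) (1, b) 0 1) (fun a => Ψ ((l, u, r, d), w) (a, 1) 1 1) =
        X l u r d := by
      simp only [Ψ, Matrix.cons_val_zero, Matrix.cons_val_one]
    rw [hX]
    simp only [Fintype.prod_prod_type, Fin.prod_univ_two, Ψ, Matrix.cons_val_zero,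
      Matrix.cons_val_one]
    ring
  simp only [hpt]
  -- factor the sum
  have hfac : ∀ (l u r d : Fin 2 → Fin D),
      ∑ w : Fin 2 → Fin 2 → Fin D,
        (∏ i : Fin 2, ∏ c : Fin 2,
          Us (![((0 : Fin 2), c), (c, 0)] i) (GB (![((0 : Fin 2), c), (c, 0)] i) i 1) (w i c) *
            star (Us (![((1 : Fin 2), c), (c, 1)] i) (GB (![((1 : Fin 2), c), (c, 1)] i) i 0) (w i c))) *
        ((∏ b, star (Us (0, b) (GB (0, b) 0 0) (l b))) * (∏ a, star (Us (a, 0) (GB (a, 0) 1 0) (u a))) *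
            (∏ b, Us (1, b) (GB (1, b) 0 1) (r b)) * (∏ a, Us (a, 1) (GB (a, 1) 1 1) (d a)) *
              X l u r d) =
      (∏ i : Fin 2, ∏ c : Fin 2,
          (Us (![((0 : Fin 2), c), (c, 0)] i) * (Us (![((1 : Fin 2), c), (c, 1)] i))ᴴ)
            (GB (![((0 : Fin 2), c), (c, 0)] i) i 1) (GB (![((1 : Fin 2), c), (c, 1)] i) i 0)) *
        ((∏ b, star (Us (0, b) (GB (0, b) 0 0) (l b))) * (∏ a, star (Us (a, 0) (GB (a, 0) 1 0) (u a))) *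
            (∏ b, Us (1, b) (GB (1, b) 0 1) (r b)) * (∏ a, Us (a, 1) (GB (a, 1) 1 1) (d a)) *
              X l u r d) := by
    intro l u r d
    rw [← Finset.sum_mul]
    congr 1
    rw [sum_legs_prod_prod (fun i c m =>
      Us (![((0 : Fin 2), c), (c, 0)] i) (GB (![((0 : Fin 2), c), (c, 0)] i) i 1) m *
        star (Us (![((1 : Fin 2), c), (c, 1)] i) (GB (![((1 : Fin 2), c), (c, 1)] i) i 0) m))]
    refine Finset.prod_congr rfl fun i _ => Finset.prod_congr rfl fun c _ => ?_
    simp only [Matrix.mul_apply, Matrix.conjTranspose_apply]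
  -- the `w`-sum is innermost after `Fintype.sum_prod_type`; bring it in and factor
  calc ∑ l : Fin 2 → Fin D, ∑ u : Fin 2 → Fin D, ∑ r : Fin 2 → Fin D, ∑ d : Fin 2 → Fin D,
        ∑ w : Fin 2 → Fin 2 → Fin D,
        (∏ i : Fin 2, ∏ c : Fin 2,
          Us (![((0 : Fin 2), c), (c, 0)] i) (GB (![((0 : Fin 2), c), (c, 0)] i) i 1) (w i c) *
            star (Us (![((1 : Fin 2), c), (c, 1)] i) (GB (![((1 : Fin 2), c), (c, 1)] i) i 0) (w i c))) *
        ((∏ b, star (Us (0, b) (GB (0, b) 0 0) (l b))) * (∏ a, star (Us (a, 0) (GB (a, 0) 1 0) (u a))) *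
            (∏ b, Us (1, b) (GB (1, b) 0 1) (r b)) * (∏ a, Us (a, 1) (GB (a, 1) 1 1) (d a)) *
              X l u r d)
      = ∑ l : Fin 2 → Fin D, ∑ u : Fin 2 → Fin D, ∑ r : Fin 2 → Fin D, ∑ d : Fin 2 → Fin D,
        (∏ i : Fin 2, ∏ c : Fin 2,
          (Us (![((0 : Fin 2), c), (c, 0)] i) * (Us (![((1 : Fin 2), c), (c, 1)] i))ᴴ)
            (GB (![((0 : Fin 2), c), (c, 0)] i) i 1) (GB (![((1 : Fin 2), c), (c, 1)] i) i 0)) *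
        ((∏ b, star (Us (0, b) (GB (0, b) 0 0) (l b))) * (∏ a, star (Us (a, 0) (GB (a, 0) 1 0) (u a))) *
            (∏ b, Us (1, b) (GB (1, b) 0 1) (r b)) * (∏ a, Us (a, 1) (GB (a, 1) 1 1) (d a)) *
              X l u r d) := by
        simp only [hfac]
    _ = _ := by
        simp only [← Finset.mul_sum]


/-- `U_a U_b† = U_{ab⁻¹}` for a unitary representation. [folklore] -/
theorem unitaryRep_mul_conjTranspose {G : Type*} [Group G] (U : G →* Matrix.unitaryGroup (Fin D) ℂ)
    (a b : G) :
    ((U a : Matrix.unitaryGroup (Fin D) ℂ) : Matrix (Fin D) (Fin D) ℂ) *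
        (((U b : Matrix.unitaryGroup (Fin D) ℂ) : Matrix (Fin D) (Fin D) ℂ))ᴴ =
      ((U (a * b⁻¹) : Matrix.unitaryGroup (Fin D) ℂ) : Matrix (Fin D) (Fin D) ℂ) := by
  rw [map_mul, map_inv, ← Matrix.star_eq_conjTranspose]
  rfl

/-- The pure gauge `κ(i,c) = γ_s γ_t⁻¹` of a blockwise gauge transformation `γ` on the four inner
bonds `s → t` of the `2 × 2` block is flat: its plaquette holonomy is trivial,
`κ(0,0) κ(1,1) = κ(1,0) κ(0,1)`. [folklore] -/
theorem blockGauge_flat {G : Type*} [Group G] (γ : Fin 2 × Fin 2 → G) :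
    (γ (0, 0) * (γ (1, 0))⁻¹) * (γ (1, 0) * (γ (1, 1))⁻¹) =
      (γ (0, 0) * (γ (0, 1))⁻¹) * (γ (0, 1) * (γ (1, 1))⁻¹) := by
  group

/-- **Local gauge form of `T^{⊗Λ} ψ` at a plaquette** (the `G`-injective form of "apply the left
inverse", Schuch–Cirac–Pérez-García (2010) Lemma 5.2 / Thm. 5.4 / eq. (27)). Let `t` be the
`G`-injective left inverse (`Σ_s t(g,s) A^s_{g'} = Π_𝒰(g,g')`) and let every slice of `ψ` along the
block at `x` be a block state. Then the virtual tensor `Φ = T^{⊗Λ} ψ` is, as a function of the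
eight legs of the four inner bonds `S_x` of that block, a combination of the pure-gauge bond
tensors `⊗_{(i,c)} U_{κ(i,c)}` with **flat** `κ` (trivial plaquette holonomy,
`κ(0,0) κ(1,1) = κ(1,0) κ(0,1)`), with coefficients `T'_κ` that do not depend on those eight legs:
`Φ(G) = Σ_κ (Π_{i,c} U_{κ(i,c)}(G_{x+s(i,c)}^{i,out}, G_{x+t(i,c)}^{i,in})) T'_κ(G)`. Mechanism:
`T^{⊗4} 𝒫^{⊗4} = Π_𝒰^{⊗4} = |G|⁻⁴ Σ_γ ⊗_p ρ(U_{γ_p})` and `(⊗_p ρ(U_{γ_p}))(δ_inner X)` is the pure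
gauge `U_{γ_s} U_{γ_t}†` on the inner bonds (`sum_legRep_block_matched`). Needs `0 < q`, `2 ≤ L`.
[cite: SchuchCiracPerezGarcia2010, Lemma 5.2 and Thm. 5.4] -/
theorem virtualT_localGaugeForm (L : ℕ) [NeZero L] (hL : 2 ≤ L) (hq : 0 < q)
    {G : Type*} [Group G] [Fintype G] [DecidableEq G]
    (U : G →* Matrix.unitaryGroup (Fin D) ℂ) (A : PEPSTensor q D)
    (t : (Fin 2 → Fin 2 → Fin D) → Fin q → ℂ)
    (ht : ∀ g g' : Fin 2 → Fin 2 → Fin D,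
      ∑ s, t g s * A s (g' 0 0) (g' 1 0) (g' 0 1) (g' 1 1) =
        (Fintype.card G : ℂ)⁻¹ *
          ∑ k : G, (fun (g g' : Fin 2 → Fin 2 → Fin D) => ∏ i : Fin 2, ∏ s : Fin 2,
            (![fun a b => star ((((U k : Matrix.unitaryGroup (Fin D) ℂ) : Matrix (Fin D) (Fin D) ℂ)) a b),
              fun a b => (((U k : Matrix.unitaryGroup (Fin D) ℂ) : Matrix (Fin D) (Fin D) ℂ)) a b] :
              Fin 2 → Fin D → Fin D → ℂ) s (g i s) (g' i s)) g g')
    (x : TorusSite 2 L) (ψ : TensorIndex (TorusSite 2 L) q → ℂ)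
    (hψ : ∀ σ : TensorIndex (TorusSite 2 L) q, ∃ X : PEPSBoundary D 2 2,
      ∀ β : torusBlock L 2 2 x → Fin q,
        ψ (Subtype.val.extend β σ) = pepsRect 2 2 A X (fun p => β (torusBlockElem L 2 2 x p)))
    {S : Finset (TorusSite 2 L × Fin 2)}
    (hS : ∀ b, b ∈ S ↔ ∃ i c : Fin 2, b = (torusBlockSite L 2 2 x (![((0 : Fin 2), c), (c, 0)] i), i)) :
    ∃ T' : (Fin 2 → Fin 2 → G) → (TorusSite 2 L → Fin 2 → Fin 2 → Fin D) → ℂ,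
      (∀ κ : Fin 2 → Fin 2 → G, κ 0 0 * κ 1 1 ≠ κ 1 0 * κ 0 1 → T' κ = 0) ∧
      (∀ (κ : Fin 2 → Fin 2 → G) (G₁ G₂ : TorusSite 2 L → Fin 2 → Fin 2 → Fin D),
        (∀ y i s, (![y - torusUnit L i, y] s, i) ∉ S → G₁ y i s = G₂ y i s) → T' κ G₁ = T' κ G₂) ∧
      (∀ G₁ : TorusSite 2 L → Fin 2 → Fin 2 → Fin D,
        (∑ σ : TensorIndex (TorusSite 2 L) q, (∏ y, t (G₁ y) (σ y)) * ψ σ) =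
          ∑ κ : Fin 2 → Fin 2 → G,
            (∏ i : Fin 2, ∏ c : Fin 2,
              ((U (κ i c) : Matrix.unitaryGroup (Fin D) ℂ) : Matrix (Fin D) (Fin D) ℂ)
                (G₁ (torusBlockSite L 2 2 x (![((0 : Fin 2), c), (c, 0)] i)) i 1)
                (G₁ (torusBlockSite L 2 2 x (![((1 : Fin 2), c), (c, 1)] i)) i 0)) * T' κ G₁) := by
  classical
  -- boundary tensors as a function of the off-block configuration
  let β₁ : torusBlock L 2 2 x → Fin q := fun _ => ⟨0, hq⟩
  have hψ' : ∀ γ : {y // y ∉ torusBlock L 2 2 x} → Fin q, ∃ X : PEPSBoundary D 2 2,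
      ∀ β : torusBlock L 2 2 x → Fin q,
        ψ (fun y => if h : y ∈ torusBlock L 2 2 x then β ⟨y, h⟩ else γ ⟨y, h⟩) =
          pepsRect 2 2 A X (fun p => β (torusBlockElem L 2 2 x p)) := by
    intro γ
    obtain ⟨X, hX⟩ := hψ (fun y => if h : y ∈ torusBlock L 2 2 x then β₁ ⟨y, h⟩ else γ ⟨y, h⟩)
    refine ⟨X, fun β => ?_⟩
    rw [glue_eq_extend_val (torusBlock L 2 2 x) β β₁ γ, hX β]
  choose Xf hXf using hψ'
  have hformula := virtualT_eq_sum_offBlock_gen L hL A t _ ht x ψ Xf hXf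
  -- abbreviations: `c = |G|⁻¹`, the pure gauge `δ γ`, the outer factor `O`
  set cG : ℂ := (Fintype.card G : ℂ)⁻¹ with hcG
  let δ : (Fin 2 × Fin 2 → G) → Fin 2 → Fin 2 → G := fun γ i c =>
    γ (![((0 : Fin 2), c), (c, 0)] i) * (γ (![((1 : Fin 2), c), (c, 1)] i))⁻¹
  let O : (Fin 2 × Fin 2 → G) → (TorusSite 2 L → Fin 2 → Fin 2 → Fin D) → PEPSBoundary D 2 2 → ℂ :=
    fun γ G₁ X => ∑ l : Fin 2 → Fin D, ∑ u : Fin 2 → Fin D, ∑ r : Fin 2 → Fin D, ∑ d : Fin 2 → Fin D,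
      (∏ b, star (((U (γ (0, b)) : Matrix.unitaryGroup (Fin D) ℂ) : Matrix (Fin D) (Fin D) ℂ)
        (G₁ (torusBlockSite L 2 2 x (0, b)) 0 0) (l b))) *
      (∏ a, star (((U (γ (a, 0)) : Matrix.unitaryGroup (Fin D) ℂ) : Matrix (Fin D) (Fin D) ℂ)
        (G₁ (torusBlockSite L 2 2 x (a, 0)) 1 0) (u a))) *
      (∏ b, ((U (γ (1, b)) : Matrix.unitaryGroup (Fin D) ℂ) : Matrix (Fin D) (Fin D) ℂ)
        (G₁ (torusBlockSite L 2 2 x (1, b)) 0 1) (r b)) *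
      (∏ a, ((U (γ (a, 1)) : Matrix.unitaryGroup (Fin D) ℂ) : Matrix (Fin D) (Fin D) ℂ)
        (G₁ (torusBlockSite L 2 2 x (a, 1)) 1 1) (d a)) * X l u r d
  let hol : (Fin 2 → Fin 2 → G) → (TorusSite 2 L → Fin 2 → Fin 2 → Fin D) → ℂ := fun κ G₁ =>
    ∏ i : Fin 2, ∏ c : Fin 2,
      ((U (κ i c) : Matrix.unitaryGroup (Fin D) ℂ) : Matrix (Fin D) (Fin D) ℂ)
        (G₁ (torusBlockSite L 2 2 x (![((0 : Fin 2), c), (c, 0)] i)) i 1)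
        (G₁ (torusBlockSite L 2 2 x (![((1 : Fin 2), c), (c, 1)] i)) i 0)
  -- the key per-block identity
  have hkey : ∀ (G₁ : TorusSite 2 L → Fin 2 → Fin 2 → Fin D) (X : PEPSBoundary D 2 2),
      (∑ G' : Fin 2 × Fin 2 → Fin 2 → Fin 2 → Fin D,
        (∏ p, (fun (g g' : Fin 2 → Fin 2 → Fin D) => cG *
          ∑ k : G, (fun (g g' : Fin 2 → Fin 2 → Fin D) => ∏ i : Fin 2, ∏ s : Fin 2,
            (![fun a b => star ((((U k : Matrix.unitaryGroup (Fin D) ℂ) : Matrix (Fin D) (Fin D) ℂ)) a b),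
              fun a b => (((U k : Matrix.unitaryGroup (Fin D) ℂ) : Matrix (Fin D) (Fin D) ℂ)) a b] :
              Fin 2 → Fin D → Fin D → ℂ) s (g i s) (g' i s)) g g') (G₁ (torusBlockSite L 2 2 x p)) (G' p)) *
          (if (∀ b : Fin 2, G' (0, b) 0 1 = G' (1, b) 0 0) ∧ (∀ a : Fin 2, G' (a, 0) 1 1 = G' (a, 1) 1 0)
            then X (fun b => G' (0, b) 0 0) (fun a => G' (a, 0) 1 0) (fun b => G' (1, b) 0 1)
              (fun a => G' (a, 1) 1 1) else 0)) =
      ∑ κ : Fin 2 → Fin 2 → G, hol κ G₁ *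
        (cG ^ 4 * ∑ γ ∈ Finset.univ.filter (fun γ => δ γ = κ), O γ G₁ X) := by
    intro G₁ X
    -- expand the product of averages into an average over blockwise gauge transformations
    have hexp : ∀ G' : Fin 2 × Fin 2 → Fin 2 → Fin 2 → Fin D,
        (∏ p, (fun (g g' : Fin 2 → Fin 2 → Fin D) => cG *
          ∑ k : G, (fun (g g' : Fin 2 → Fin 2 → Fin D) => ∏ i : Fin 2, ∏ s : Fin 2,
            (![fun a b => star ((((U k : Matrix.unitaryGroup (Fin D) ℂ) : Matrix (Fin D) (Fin D) ℂ)) a b),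
              fun a b => (((U k : Matrix.unitaryGroup (Fin D) ℂ) : Matrix (Fin D) (Fin D) ℂ)) a b] :
              Fin 2 → Fin D → Fin D → ℂ) s (g i s) (g' i s)) g g') (G₁ (torusBlockSite L 2 2 x p)) (G' p)) =
        cG ^ 4 * ∑ γ : Fin 2 × Fin 2 → G, ∏ p,
          (fun (g g' : Fin 2 → Fin 2 → Fin D) => ∏ i : Fin 2, ∏ s : Fin 2,
            (![fun a b => star ((((U (γ p) : Matrix.unitaryGroup (Fin D) ℂ) : Matrix (Fin D) (Fin D) ℂ)) a b),
              fun a b => (((U (γ p) : Matrix.unitaryGroup (Fin D) ℂ) : Matrix (Fin D) (Fin D) ℂ)) a b] :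
              Fin 2 → Fin D → Fin D → ℂ) s (g i s) (g' i s)) (G₁ (torusBlockSite L 2 2 x p)) (G' p) := by
      intro G'
      rw [Finset.prod_mul_distrib, Finset.prod_const, Finset.card_univ]
      have h4 : Fintype.card (Fin 2 × Fin 2) = 4 := by simp
      rw [h4, Fintype.prod_sum]
    simp only [hexp]
    calc ∑ G' : Fin 2 × Fin 2 → Fin 2 → Fin 2 → Fin D, (cG ^ 4 * ∑ γ : Fin 2 × Fin 2 → G, ∏ p,
          (fun (g g' : Fin 2 → Fin 2 → Fin D) => ∏ i : Fin 2, ∏ s : Fin 2,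
            (![fun a b => star ((((U (γ p) : Matrix.unitaryGroup (Fin D) ℂ) : Matrix (Fin D) (Fin D) ℂ)) a b),
              fun a b => (((U (γ p) : Matrix.unitaryGroup (Fin D) ℂ) : Matrix (Fin D) (Fin D) ℂ)) a b] :
              Fin 2 → Fin D → Fin D → ℂ) s (g i s) (g' i s)) (G₁ (torusBlockSite L 2 2 x p)) (G' p)) *
          (if (∀ b : Fin 2, G' (0, b) 0 1 = G' (1, b) 0 0) ∧ (∀ a : Fin 2, G' (a, 0) 1 1 = G' (a, 1) 1 0)
            then X (fun b => G' (0, b) 0 0) (fun a => G' (a, 0) 1 0) (fun b => G' (1, b) 0 1)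
              (fun a => G' (a, 1) 1 1) else 0)
        = cG ^ 4 * ∑ γ : Fin 2 × Fin 2 → G, ∑ G' : Fin 2 × Fin 2 → Fin 2 → Fin 2 → Fin D, (∏ p,
          (fun (g g' : Fin 2 → Fin 2 → Fin D) => ∏ i : Fin 2, ∏ s : Fin 2,
            (![fun a b => star ((((U (γ p) : Matrix.unitaryGroup (Fin D) ℂ) : Matrix (Fin D) (Fin D) ℂ)) a b),
              fun a b => (((U (γ p) : Matrix.unitaryGroup (Fin D) ℂ) : Matrix (Fin D) (Fin D) ℂ)) a b] :
              Fin 2 → Fin D → Fin D → ℂ) s (g i s) (g' i s)) (G₁ (torusBlockSite L 2 2 x p)) (G' p)) *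
          (if (∀ b : Fin 2, G' (0, b) 0 1 = G' (1, b) 0 0) ∧ (∀ a : Fin 2, G' (a, 0) 1 1 = G' (a, 1) 1 0)
            then X (fun b => G' (0, b) 0 0) (fun a => G' (a, 0) 1 0) (fun b => G' (1, b) 0 1)
              (fun a => G' (a, 1) 1 1) else 0) := by
          simp only [Finset.mul_sum, Finset.sum_mul, mul_assoc]
          exact Finset.sum_comm
      _ = cG ^ 4 * ∑ γ : Fin 2 × Fin 2 → G, hol (δ γ) G₁ * O γ G₁ X := by
          congr 1
          refine Finset.sum_congr rfl fun γ _ => ?_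
          rw [sum_legRep_block_matched (fun p => ((U (γ p) : Matrix.unitaryGroup (Fin D) ℂ) :
            Matrix (Fin D) (Fin D) ℂ)) (fun p => G₁ (torusBlockSite L 2 2 x p)) X]
          simp only [hol, δ, O, unitaryRep_mul_conjTranspose]
      _ = ∑ κ : Fin 2 → Fin 2 → G, hol κ G₁ *
          (cG ^ 4 * ∑ γ ∈ Finset.univ.filter (fun γ => δ γ = κ), O γ G₁ X) := by
          rw [Finset.mul_sum, ← Finset.sum_fiberwise_of_maps_to (g := δ) (t := Finset.univ)
            (fun _ _ => Finset.mem_univ _)]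
          refine Finset.sum_congr rfl fun κ _ => ?_
          rw [Finset.mul_sum, Finset.mul_sum]
          refine Finset.sum_congr rfl fun γ hγ => ?_
          rw [(Finset.mem_filter.1 hγ).2]
          ring
  -- the coefficient tensors
  refine ⟨fun κ G₁ => ∑ γo : {y // y ∉ torusBlock L 2 2 x} → Fin q,
      (∏ y : {y // y ∉ torusBlock L 2 2 x}, t (G₁ y) (γo y)) *
        (cG ^ 4 * ∑ γ ∈ Finset.univ.filter (fun γ => δ γ = κ), O γ G₁ (Xf γo)), ?_, ?_, ?_⟩
  · -- non-flat `κ` do not occur: every pure gauge `δ γ` is flat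
    intro κ hκ
    have hempty : Finset.univ.filter (fun γ => δ γ = κ) = ∅ := by
      refine Finset.filter_eq_empty_iff.2 fun γ _ hγκ => hκ ?_
      rw [← hγκ]
      exact blockGauge_flat γ
    funext G₁
    simp [hempty]
  · -- independence of the legs of the inner bonds
    intro κ G₁ G₂ hGG
    have hoff : ∀ y : {y // y ∉ torusBlock L 2 2 x}, G₁ y = G₂ y := by
      intro y
      funext i s
      refine hGG y i s fun hmem => y.2 ?_
      obtain ⟨p, hp⟩ := exists_eq_torusBlockSite_of_legBond_mem x hS hmem
      rw [hp]
      exact Finset.mem_image_of_mem _ (Finset.mem_univ p)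
    have hout : ∀ (p : Fin 2 × Fin 2) (i s : Fin 2), ![p.1, p.2] i = s →
        G₁ (torusBlockSite L 2 2 x p) i s = G₂ (torusBlockSite L 2 2 x p) i s := by
      intro p i s hps
      refine hGG _ _ _ fun h => ?_
      rw [legBond_torusBlockSite_mem_iff hL x hS] at h
      exact h hps
    have hO : ∀ (γ : Fin 2 × Fin 2 → G) (X : PEPSBoundary D 2 2), O γ G₁ X = O γ G₂ X := by
      intro γ X
      simp only [O]
      simp only [hout (0, _) 0 0 rfl, hout (_, 0) 1 0 rfl, hout (1, _) 0 1 rfl, hout (_, 1) 1 1 rfl]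
    simp only [hO]
    congr 1
    funext γo
    congr 1
    exact Finset.prod_congr rfl fun y _ => by rw [hoff y]
  · -- the formula
    intro G₁
    rw [hformula G₁]
    simp only [hkey, hol]
    simp only [Finset.mul_sum]
    rw [Finset.sum_comm]
    refine Finset.sum_congr rfl fun κ _ => Finset.sum_congr rfl fun γo _ =>
      Finset.sum_congr rfl fun γ _ => ?_
    ring


/-! ### The twisted torus PEPS in leg coordinates -/

/-- **The `(P,Q)`-closed torus PEPS in leg coordinates**: `pepsTorusTwisted L A P Q = 𝒫^{⊗Λ}(Ω_{P,Q})`,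
where the virtual tensor `Ω_{P,Q}(G) = Π_{bonds (z,i)} w_{z,i}(G_z^{i,out}, G_{z+e_i}^{i,in})` carries
the matrix `P` on the horizontal bonds leaving the column `-1`, `Q` on the vertical bonds leaving
the row `-1`, and `δ` on all other bonds (`seamWeight`). Schuch–Cirac–Pérez-García (2010) Def. 5.6.
[cite: SchuchCiracPerezGarcia2010, Def. 5.6] -/
theorem pepsTorusTwisted_eq_sum_legs (L : ℕ) [NeZero L] (A : PEPSTensor q D)
    (P Q : Matrix (Fin D) (Fin D) ℂ) (σ : TensorIndex (TorusSite 2 L) q) :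
    pepsTorusTwisted L A P Q σ = ∑ G : TorusSite 2 L → Fin 2 → Fin 2 → Fin D,
      (∏ y, A (σ y) (G y 0 0) (G y 1 0) (G y 0 1) (G y 1 1)) *
        ∏ z : TorusSite 2 L, (seamWeight P (z 0 = -1) (G z 0 1) (G (z + torusUnit L 0) 0 0) *
          seamWeight Q (z 1 = -1) (G z 1 1) (G (z + torusUnit L 1) 1 0)) := by
  -- the bijection (η, η', ν, ν') ↦ G
  let e : ((TorusSite 2 L → Fin D) × (TorusSite 2 L → Fin D)) ×
      ((TorusSite 2 L → Fin D) × (TorusSite 2 L → Fin D)) ≃ (TorusSite 2 L → Fin 2 → Fin 2 → Fin D) :=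
    { toFun := fun v y => ![![v.1.2 (y - torusUnit L 0), v.1.1 y], ![v.2.2 (y - torusUnit L 1), v.2.1 y]]
      invFun := fun G => ((fun y => G y 0 1, fun y => G (y + torusUnit L 0) 0 0),
        (fun y => G y 1 1, fun y => G (y + torusUnit L 1) 1 0))
      left_inv := by
        rintro ⟨⟨η, η'⟩, ⟨ν, ν'⟩⟩
        simp
      right_inv := by
        intro G
        funext y i s
        fin_cases i <;> fin_cases s <;> simp }
  rw [← e.sum_comp]
  simp only [pepsTorusTwisted, Fintype.sum_prod_type]
  refine Finset.sum_congr rfl fun η _ => Finset.sum_congr rfl fun η' _ =>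
    Finset.sum_congr rfl fun ν _ => Finset.sum_congr rfl fun ν' _ => ?_
  simp only [e, Equiv.coe_fn_mk, Matrix.cons_val_zero, Matrix.cons_val_one, add_sub_cancel_right,
    ← Finset.prod_mul_distrib]


/-! ### Semi-regularity: dual functionals to the matrices `U_k` -/

/-- **Dual functionals of a semi-regular representation.** If the matrices `U_k`, `k ∈ G`, are
linearly independent (`IsSemiregularRep`, Schuch–Cirac–Pérez-García (2010) Def. 4.5 / Lemma 4.6:
"linear independence of semi-regular representations", there realised by `X ↦ tr[U_k† X Δ]`),
then there are tensors `d_k` with `Σ_{a,b} d_k(a,b) (U_h)_{ab} = δ_{k,h}`: a left inverse of the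
injective map `c ↦ Σ_k c_k U_k` read in coordinates. [cite: SchuchCiracPerezGarcia2010, Lemma 4.6] -/
theorem exists_dual_of_isSemiregularRep {G : Type*} [Group G] [Fintype G] [DecidableEq G]
    (U : G →* Matrix.unitaryGroup (Fin D) ℂ) (hU : IsSemiregularRep U) :
    ∃ d : G → Fin D → Fin D → ℂ, ∀ k h : G,
      ∑ a, ∑ b, d k a b * ((U h : Matrix.unitaryGroup (Fin D) ℂ) : Matrix (Fin D) (Fin D) ℂ) a b =
        if k = h then 1 else 0 := by
  classical
  let Φ : (G → ℂ) →ₗ[ℂ] Matrix (Fin D) (Fin D) ℂ :=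
    { toFun := fun c => ∑ g, c g • ((U g : Matrix.unitaryGroup (Fin D) ℂ) : Matrix (Fin D) (Fin D) ℂ)
      map_add' := fun c c' => by
        simp only [Pi.add_apply, add_smul, Finset.sum_add_distrib]
      map_smul' := fun a c => by
        simp only [Pi.smul_apply, smul_eq_mul, RingHom.id_apply, Finset.smul_sum, smul_smul] }
  have hΦ : ∀ c, Φ c = ∑ g, c g • ((U g : Matrix.unitaryGroup (Fin D) ℂ) : Matrix (Fin D) (Fin D) ℂ) :=
    fun c => rfl
  have hker : LinearMap.ker Φ = ⊥ := by
    rw [LinearMap.ker_eq_bot']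
    intro c hc
    funext g
    exact Fintype.linearIndependent_iff.1 hU c hc g
  obtain ⟨Ψ, hΨ⟩ := Φ.exists_leftInverse_of_injective hker
  refine ⟨fun k a b => Ψ (Matrix.single a b 1) k, fun k h => ?_⟩
  have hUh : ((U h : Matrix.unitaryGroup (Fin D) ℂ) : Matrix (Fin D) (Fin D) ℂ) = Φ (Pi.single h 1) := by
    rw [hΦ]
    simp only [Pi.single_apply, ite_smul, one_smul, zero_smul, Finset.sum_ite_eq', Finset.mem_univ,
      if_true]
  have hsingle : Ψ (Φ (Pi.single h 1)) = Pi.single h 1 := by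
    rw [← LinearMap.comp_apply, hΨ, LinearMap.id_apply]
  calc ∑ a, ∑ b, Ψ (Matrix.single a b 1) k *
        ((U h : Matrix.unitaryGroup (Fin D) ℂ) : Matrix (Fin D) (Fin D) ℂ) a b
      = Ψ (∑ a, ∑ b, Matrix.single a b
          (((U h : Matrix.unitaryGroup (Fin D) ℂ) : Matrix (Fin D) (Fin D) ℂ) a b)) k := by
        simp only [map_sum, Finset.sum_apply]
        refine Finset.sum_congr rfl fun a _ => Finset.sum_congr rfl fun b _ => ?_
        rw [show Matrix.single a b (((U h : Matrix.unitaryGroup (Fin D) ℂ) : Matrix (Fin D) (Fin D) ℂ) a b) =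
          ((U h : Matrix.unitaryGroup (Fin D) ℂ) : Matrix (Fin D) (Fin D) ℂ) a b • Matrix.single a b (1 : ℂ)
          by rw [Matrix.smul_single, smul_eq_mul, mul_one], map_smul]
        simp [mul_comm]
    _ = Ψ (((U h : Matrix.unitaryGroup (Fin D) ℂ) : Matrix (Fin D) (Fin D) ℂ)) k := by
        rw [← Matrix.matrix_eq_sum_single]
    _ = if k = h then 1 else 0 := by
        rw [hUh, hsingle, Pi.single_apply]


/-! ### Expansion in the bond tensors `⊗_b U_{κ_b}` (generic coordinates)

The virtual tensor, read in bond coordinates `H : R → α` (`R` the bonds, `α` the pair of leg values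
of a bond), is expanded in the pure tensors `⊗_b u_{κ_b}` (`u_k` the entries of `U_k`) using the
dual functionals `d_k` of `exists_dual_of_isSemiregularRep`: the bond projection
`P = Σ_k u_k ⊗ d_k` onto `span{u_k}` fixes the tensor at every bond (because at every bond it is
"some `u_k` times a function of the other bonds", `bondExp_fix_of_localForm`), hence `⊗_b P`
fixes it (`sum_prod_mul_eq_self_of_forall_update_gen`) and this is the expansion
(`bondExp_expand`), with coefficients `c_κ = ⟨⊗_b d_{κ_b}, Φ⟩` that vanish unless `κ` is flat
on every plaquette (`bondExp_coeff_eq_zero`). -/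

/-- **Tensor powers of a single-site identity**, for an arbitrary finite alphabet (the argument of
`sum_prod_mul_eq_self_of_forall_update`): if `Σ_s π(σ_y, s) ψ(σ[y ↦ s]) = ψ(σ)` for every site
`y`, then `Σ_τ (Π_x π(σ_x, τ_x)) ψ(τ) = ψ(σ)`. [folklore] -/
theorem sum_prod_mul_eq_self_of_forall_update_gen {R α : Type*} [Fintype R] [DecidableEq R]
    [Fintype α] [DecidableEq α] (π : α → α → ℂ) (ψ : (R → α) → ℂ)
    (hψ : ∀ (y : R) (σ : R → α), ∑ s, π (σ y) s * ψ (Function.update σ y s) = ψ σ)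
    (σ : R → α) : ∑ τ : R → α, (∏ x, π (σ x) (τ x)) * ψ τ = ψ σ := by
  suffices h : ∀ (S : Finset R) (σ : R → α), ∑ τ : R → α,
      (∏ x, if x ∈ S then π (σ x) (τ x) else if τ x = σ x then 1 else 0) * ψ τ = ψ σ by
    simpa using h Finset.univ σ
  intro S
  induction S using Finset.induction_on with
  | empty =>
    intro σ
    simp only [Finset.notMem_empty, if_false, prod_ite_apply_eq]
    simp [Finset.sum_ite_eq']
  | insert y S hy ih =>
    intro σ
    have hoff : ∀ (s : α) (τ : R → α),
        (∏ x ∈ Finset.univ.erase y, if x ∈ S then π (Function.update σ y s x) (τ x)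
          else if τ x = Function.update σ y s x then 1 else 0) =
        ∏ x ∈ Finset.univ.erase y,
          if x ∈ insert y S then π (σ x) (τ x) else if τ x = σ x then 1 else 0 := by
      intro s τ
      refine Finset.prod_congr rfl fun x hx => ?_
      have hxy : x ≠ y := Finset.ne_of_mem_erase hx
      rw [Function.update_of_ne hxy]
      simp only [Finset.mem_insert, hxy, false_or]
    have hexp : ∀ τ : R → α,
        (∏ x, if x ∈ insert y S then π (σ x) (τ x) else if τ x = σ x then 1 else 0) =
          ∑ s, π (σ y) s * ∏ x, if x ∈ S then π (Function.update σ y s x) (τ x)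
            else if τ x = Function.update σ y s x then 1 else 0 := by
      intro τ
      have h1 : ∀ s, (∏ x, if x ∈ S then π (Function.update σ y s x) (τ x)
            else if τ x = Function.update σ y s x then 1 else 0) =
          (if τ y = s then 1 else 0) * ∏ x ∈ Finset.univ.erase y,
            if x ∈ insert y S then π (σ x) (τ x) else if τ x = σ x then 1 else 0 := by
        intro s
        rw [← Finset.mul_prod_erase _ _ (Finset.mem_univ y), hoff s τ]
        simp only [hy, if_false, Function.update_self]
      rw [← Finset.mul_prod_erase _ _ (Finset.mem_univ y)]
      simp only [h1, ← mul_assoc, ← Finset.sum_mul, Finset.mem_insert, true_or, if_true]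
      congr 1
      simp only [mul_ite, mul_one, mul_zero]
      rw [Finset.sum_ite_eq, if_pos (Finset.mem_univ _)]
    simp only [hexp, Finset.sum_mul, mul_assoc]
    rw [Finset.sum_comm]
    simp only [← Finset.mul_sum, ih]
    exact hψ y σ

/-- **Expansion in bond tensors.** If the bond projection `P(m, m') = Σ_k u_k(m) d_k(m')` fixes `Φ`
at every bond, then `Φ(H) = Σ_κ (Π_b u_{κ_b}(H_b)) c_κ` with `c_κ = Σ_{H'} (Π_b d_{κ_b}(H'_b)) Φ(H')`
(`⊗_b P` fixes `Φ`, and `⊗_b Σ_k u_k ⊗ d_k = Σ_κ (⊗_b u_{κ_b}) ⊗ (⊗_b d_{κ_b})`). [folklore] -/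
theorem bondExp_expand {R α K : Type*} [Fintype R] [DecidableEq R] [Fintype α] [DecidableEq α]
    [Fintype K] [DecidableEq K] (u d : K → α → ℂ) (Φ : (R → α) → ℂ)
    (hfix : ∀ (b : R) (H : R → α),
      ∑ m, (∑ k, u k (H b) * d k m) * Φ (Function.update H b m) = Φ H)
    (H : R → α) :
    Φ H = ∑ κ : R → K, (∏ b, u (κ b) (H b)) * ∑ H' : R → α, (∏ b, d (κ b) (H' b)) * Φ H' := by
  rw [← sum_prod_mul_eq_self_of_forall_update_gen (fun m m' => ∑ k, u k m * d k m') Φ hfix H]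
  simp only [Fintype.prod_sum, Finset.prod_mul_distrib, Finset.sum_mul, Finset.mul_sum]
  rw [Finset.sum_comm]
  refine Finset.sum_congr rfl fun κ _ => Finset.sum_congr rfl fun H' _ => ?_
  ring

/-- **The bond projection fixes a tensor in single-bond `𝒜`-form.** If at the bond `b₀` the tensor
is `Φ(H) = Σ_k u_k(H_{b₀}) R_k(H)` with `R_k` independent of `H_{b₀}`, and `d` is dual to `u`
(`Σ_m d_k(m) u_h(m) = δ_{k,h}`), then `Σ_m P(H_{b₀}, m) Φ(H[b₀ ↦ m]) = Φ(H)`. [folklore] -/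
theorem bondExp_fix_of_localForm {R α K : Type*} [Fintype R] [DecidableEq R] [Fintype α]
    [DecidableEq α] [Fintype K] [DecidableEq K] (u d : K → α → ℂ)
    (hd : ∀ k h : K, ∑ m, d k m * u h m = if k = h then 1 else 0)
    (Φ : (R → α) → ℂ) (b₀ : R) (Rk : K → (R → α) → ℂ)
    (hloc : ∀ H, Φ H = ∑ k, u k (H b₀) * Rk k H)
    (hR : ∀ (k : K) (H : R → α) (m : α), Rk k (Function.update H b₀ m) = Rk k H) (H : R → α) :
    ∑ m, (∑ k, u k (H b₀) * d k m) * Φ (Function.update H b₀ m) = Φ H := by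
  simp only [hloc, hR, Function.update_self]
  calc ∑ m, (∑ k, u k (H b₀) * d k m) * ∑ k, u k m * Rk k H
      = ∑ k, ∑ k', u k' (H b₀) * (∑ m, d k' m * u k m) * Rk k H := by
        simp only [Finset.sum_mul, Finset.mul_sum]
        rw [Finset.sum_comm]
        refine Finset.sum_congr rfl fun k' _ => ?_
        rw [Finset.sum_comm]
        refine Finset.sum_congr rfl fun k _ => Finset.sum_congr rfl fun m _ => ?_
        ring
    _ = ∑ k, u k (H b₀) * Rk k H := by
        refine Finset.sum_congr rfl fun k _ => ?_
        simp only [hd, mul_ite, mul_one, mul_zero, ite_mul, zero_mul, Finset.sum_ite_eq',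
          Finset.mem_univ, if_true]

/-- **From the plaquette form to the single-bond form.** If `Φ(H) = Σ_{κ} (Π_j u_{κ_j}(H_{bnd j})) T_κ(H)`
with `bnd` an injective family of bonds and `T_κ` independent of the bonds `bnd j`, then at each
bond `bnd j₀` the tensor is in single-bond form `Σ_k u_k(H_{bnd j₀}) R_k(H)` with `R_k` independent
of `H_{bnd j₀}` (group the `κ` by `κ_{j₀}`). [folklore] -/
theorem bondExp_localForm_of_plaquette {R α K ι : Type*} [Fintype R] [DecidableEq R] [Fintype α]
    [DecidableEq α] [Fintype K] [DecidableEq K] [Fintype ι] [DecidableEq ι] (u : K → α → ℂ)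
    (Φ : (R → α) → ℂ) (bnd : ι → R) (hbnd : Function.Injective bnd) (T : (ι → K) → (R → α) → ℂ)
    (hplaq : ∀ H, Φ H = ∑ κ : ι → K, (∏ j, u (κ j) (H (bnd j))) * T κ H)
    (hT : ∀ (κ : ι → K) (j : ι) (H : R → α) (m : α), T κ (Function.update H (bnd j) m) = T κ H)
    (j₀ : ι) :
    ∃ Rk : K → (R → α) → ℂ, (∀ H, Φ H = ∑ k, u k (H (bnd j₀)) * Rk k H) ∧
      (∀ (k : K) (H : R → α) (m : α), Rk k (Function.update H (bnd j₀) m) = Rk k H) := by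
  refine ⟨fun k H => ∑ κ ∈ Finset.univ.filter (fun κ : ι → K => κ j₀ = k),
    (∏ j ∈ Finset.univ.erase j₀, u (κ j) (H (bnd j))) * T κ H, fun H => ?_, fun k H m => ?_⟩
  · rw [hplaq H, ← Finset.sum_fiberwise_of_maps_to (g := fun κ : ι → K => κ j₀) (t := Finset.univ)
      (fun _ _ => Finset.mem_univ _)]
    refine Finset.sum_congr rfl fun k _ => ?_
    rw [Finset.mul_sum]
    refine Finset.sum_congr rfl fun κ hκ => ?_
    rw [← (Finset.mem_filter.1 hκ).2, ← Finset.mul_prod_erase _ _ (Finset.mem_univ j₀)]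
    ring
  · refine Finset.sum_congr rfl fun κ _ => ?_
    rw [hT]
    congr 1
    refine Finset.prod_congr rfl fun j hj => ?_
    rw [Function.update_of_ne (fun h => Finset.ne_of_mem_erase hj (hbnd h))]

/-- **Factorising a configuration sum at one bond.** If `g` does not depend on the value at `b₀`,
then `Σ_H f(H_{b₀}) g(H) = (Σ_m f m) · Σ_{rest} g(m₀ ⊔ rest)` (`Equiv.funSplitAt`). [folklore] -/
theorem sum_mul_eq_sum_mul_sum_of_update {R α : Type*} [Fintype R] [DecidableEq R] [Fintype α]
    (b₀ : R) (f : α → ℂ) (g : (R → α) → ℂ)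
    (hg : ∀ (H : R → α) (m : α), g (Function.update H b₀ m) = g H) (m₀ : α) :
    ∑ H : R → α, f (H b₀) * g H =
      (∑ m, f m) * ∑ rest : {b // b ≠ b₀} → α, g ((Equiv.funSplitAt b₀ α).symm (m₀, rest)) := by
  set e := Equiv.funSplitAt b₀ α with he
  have hval : ∀ (m : α) (rest : {b // b ≠ b₀} → α), e.symm (m, rest) b₀ = m := fun m rest =>
    congrArg Prod.fst (e.apply_symm_apply (m, rest))
  have hupd : ∀ (m : α) (rest : {b // b ≠ b₀} → α),
      e.symm (m, rest) = Function.update (e.symm (m₀, rest)) b₀ m := by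
    intro m rest
    apply e.injective
    rw [e.apply_symm_apply]
    have h2 := congrArg Prod.snd (e.apply_symm_apply (m₀, rest))
    refine Prod.ext (by simp [he]) ?_
    funext j
    have hj : Function.update (e.symm (m₀, rest)) b₀ m j = e.symm (m₀, rest) j :=
      Function.update_of_ne j.2 _ _
    simp only [he, Equiv.funSplitAt_apply] at h2 ⊢
    rw [hj]
    exact (congrFun h2 j).symm
  rw [← e.symm.sum_comp, Fintype.sum_prod_type, Finset.sum_mul]
  refine Finset.sum_congr rfl fun m _ => ?_
  rw [Finset.mul_sum]
  refine Finset.sum_congr rfl fun rest _ => ?_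
  rw [hval, hupd m rest, hg]

/-- **The coefficients of non-flat configurations vanish.** With `c_κ = Σ_{H} (Π_b d_{κ_b}(H_b)) Φ(H)`
and `Φ` in plaquette form `Σ_{κ'} (Π_j u_{κ'_j}(H_{bnd j})) T_{κ'}(H)` where only *flat* `κ'` occur
(`T_{κ'} = 0` otherwise) and `T_{κ'}` does not depend on the bonds `bnd j`: if the restriction
`κ ∘ bnd` is not flat then `c_κ = 0` — by duality only `κ' = κ ∘ bnd` could contribute.
[folklore] -/
theorem bondExp_coeff_eq_zero {R α K ι : Type*} [Fintype R] [DecidableEq R] [Fintype α]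
    [DecidableEq α] [Fintype K] [DecidableEq K] [Fintype ι] [DecidableEq ι] (u d : K → α → ℂ)
    (hd : ∀ k h : K, ∑ m, d k m * u h m = if k = h then 1 else 0)
    (Φ : (R → α) → ℂ) (bnd : ι → R) (hbnd : Function.Injective bnd) (T : (ι → K) → (R → α) → ℂ)
    (flat : (ι → K) → Prop)
    (hplaq : ∀ H, Φ H = ∑ κ : ι → K, (∏ j, u (κ j) (H (bnd j))) * T κ H)
    (hT : ∀ (κ : ι → K) (j : ι) (H : R → α) (m : α), T κ (Function.update H (bnd j) m) = T κ H)
    (hT0 : ∀ κ : ι → K, ¬ flat κ → T κ = 0) (κ : R → K) (hκ : ¬ flat (κ ∘ bnd)) :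
    ∑ H : R → α, (∏ b, d (κ b) (H b)) * Φ H = 0 := by
  classical
  simp only [hplaq, Finset.mul_sum]
  rw [Finset.sum_comm]
  refine Finset.sum_eq_zero fun κ' _ => ?_
  by_cases h : κ' = κ ∘ bnd
  · subst h
    simp [hT0 _ hκ]
  · obtain ⟨j₀, hj₀⟩ : ∃ j₀, κ' j₀ ≠ κ (bnd j₀) := by
      by_contra hc
      push Not at hc
      exact h (funext hc)
    set b₀ := bnd j₀ with hb₀
    rcases isEmpty_or_nonempty α with hα | ⟨⟨m₀⟩⟩
    · haveI : Nonempty R := ⟨b₀⟩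
      simp
    -- factorise the summand at the bond `b₀`
    let g : (R → α) → ℂ := fun H => (∏ b ∈ Finset.univ.erase b₀, d (κ b) (H b)) *
      ((∏ j ∈ Finset.univ.erase j₀, u (κ' j) (H (bnd j))) * T κ' H)
    have hsummand : ∀ H : R → α, (∏ b, d (κ b) (H b)) * ((∏ j, u (κ' j) (H (bnd j))) * T κ' H) =
        (d (κ b₀) (H b₀) * u (κ' j₀) (H b₀)) * g H := by
      intro H
      rw [← Finset.mul_prod_erase _ _ (Finset.mem_univ b₀),
        ← Finset.mul_prod_erase Finset.univ (fun j => u (κ' j) (H (bnd j))) (Finset.mem_univ j₀)]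
      simp only [g]
      ring
    have hg : ∀ (H : R → α) (m : α), g (Function.update H b₀ m) = g H := by
      intro H m
      simp only [g]
      rw [hb₀, hT]
      congr 1
      · exact Finset.prod_congr rfl fun b hb => by
          rw [Function.update_of_ne (Finset.ne_of_mem_erase hb)]
      · congr 1
        exact Finset.prod_congr rfl fun j hj => by
          rw [Function.update_of_ne (fun h => Finset.ne_of_mem_erase hj (hbnd h))]
    simp only [hsummand]
    rw [sum_mul_eq_sum_mul_sum_of_update b₀ (fun m => d (κ b₀) m * u (κ' j₀) m) g hg m₀, hd,
      if_neg (Ne.symm hj₀), zero_mul]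


/-! ### Bond coordinates on the torus and the expansion of `T^{⊗Λ} ψ` in flat bond tensors -/

/-- Bond coordinates → leg coordinates → bond coordinates is the identity: reading the two legs
of every bond `(z, i)` (`out = G z i 1`, `in = G (z + e_i) i 0`) and reassembling. [folklore] -/
theorem toSite_toBond {L : ℕ} (G₁ : TorusSite 2 L → Fin 2 → Fin 2 → Fin D) :
    (fun (y : TorusSite 2 L) (i s : Fin 2) =>
      (![(fun b : TorusSite 2 L × Fin 2 => (![G₁ b.1 b.2 1, G₁ (b.1 + torusUnit L b.2) b.2 0] :
          Fin 2 → Fin D)) (y - torusUnit L i, i) 1,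
        (fun b : TorusSite 2 L × Fin 2 => (![G₁ b.1 b.2 1, G₁ (b.1 + torusUnit L b.2) b.2 0] :
          Fin 2 → Fin D)) (y, i) 0] : Fin 2 → Fin D) s) = G₁ := by
  funext y i s
  fin_cases s <;> simp

/-- Leg coordinates → bond coordinates → leg coordinates is the identity. [folklore] -/
theorem toBond_toSite {L : ℕ} (H : TorusSite 2 L × Fin 2 → Fin 2 → Fin D) :
    (fun b : TorusSite 2 L × Fin 2 =>
      (![(fun (y : TorusSite 2 L) (i s : Fin 2) => (![H (y - torusUnit L i, i) 1, H (y, i) 0] :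
          Fin 2 → Fin D) s) b.1 b.2 1,
        (fun (y : TorusSite 2 L) (i s : Fin 2) => (![H (y - torusUnit L i, i) 1, H (y, i) 0] :
          Fin 2 → Fin D) s) (b.1 + torusUnit L b.2) b.2 0] : Fin 2 → Fin D)) = H := by
  funext b s
  fin_cases s <;> simp

/-- The base site of an inner bond is the far site minus the unit vector. [folklore] -/
theorem torusBlockSite_innerFar_sub_unit (L : ℕ) (x : TorusSite 2 L) (i c : Fin 2) :
    torusBlockSite L 2 2 x (![((1 : Fin 2), c), (c, 1)] i) - torusUnit L i =
      torusBlockSite L 2 2 x (![((0 : Fin 2), c), (c, 0)] i) :=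
  sub_eq_of_eq_add (torusBlockSite_innerBase_add_unit L x i c).symm

/-- The block sites `(1,0)` and `(0,1)` are the anchor shifted by the unit vectors. [folklore] -/
theorem torusBlockSite_unit (L : ℕ) (x : TorusSite 2 L) (i : Fin 2) :
    torusBlockSite L 2 2 x (![((1 : Fin 2), (0 : Fin 2)), (0, 1)] i) = x + torusUnit L i := by
  unfold torusBlockSite torusUnit
  congr 1
  ext j
  fin_cases i <;> fin_cases j <;> simp

/-- The inner bonds `(i, c) ↦ (x + s(i,c), i)` of the block anchored at `x` are pairwise distinct
(`2 ≤ L`). [folklore] -/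
theorem innerBond_injective {L : ℕ} (hL : 2 ≤ L) (x : TorusSite 2 L) :
    Function.Injective (fun j : Fin 2 × Fin 2 =>
      (torusBlockSite L 2 2 x (![((0 : Fin 2), j.2), (j.2, 0)] j.1), j.1)) := by
  rintro ⟨i, c⟩ ⟨i', c'⟩ h
  obtain ⟨h1, h2⟩ := Prod.mk.inj h
  dsimp only at h2
  subst h2
  have h3 := torusBlockSite_injective L 2 2 hL hL x h1
  fin_cases i <;> fin_cases c <;> fin_cases c' <;> simp_all

/-- **Expansion of `T^{⊗Λ} ψ` in flat bond tensors** (the `G`-injective replacement of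
"`T^{⊗Λ} ψ ∈ V_{all bonds} = ℂ δ_all`" of the injective case). Let `U` be semi-regular, `A`
`G`-invariant with `G`-injective left inverse `t`, and let every `2 × 2` block slice of `ψ` be a
block state (`2 ≤ L`, `0 < q`). Then the virtual tensor `Φ = T^{⊗Λ} ψ` is a combination of the
bond tensors `⊗_{(z,i)} U_{κ(z,i)}` (`(z,i)` running over all bonds of the torus), and only
configurations `κ : bonds → G` that are **flat on every plaquette**,
`κ(x,0) κ(x+e₀,1) = κ(x,1) κ(x+e₁,0)`, occur. Mechanism: the local gauge form at every plaquette
(`virtualT_localGaugeForm`) puts `Φ`, bond by bond, into `span{U_k} ⊗ (rest)`; the bond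
projections built from the dual functionals of the `U_k` (`exists_dual_of_isSemiregularRep`,
Lemma 4.6) then expand `Φ` (`bondExp_expand`), and duality kills the non-flat coefficients
(`bondExp_coeff_eq_zero`). Schuch–Cirac–Pérez-García (2010), proof of Thm. 5.5 (the comparison
of the virtual tensors after applying the left inverses, eqs. (35)–(36)).
[cite: SchuchCiracPerezGarcia2010, Thm. 5.5] -/
theorem virtualT_bondExpansion (L : ℕ) [NeZero L] (hL : 2 ≤ L) (hq : 0 < q)
    {G : Type*} [Group G] [Fintype G] [DecidableEq G]
    (U : G →* Matrix.unitaryGroup (Fin D) ℂ) (hU : IsSemiregularRep U) (A : PEPSTensor q D)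
    (t : (Fin 2 → Fin 2 → Fin D) → Fin q → ℂ)
    (ht : ∀ g g' : Fin 2 → Fin 2 → Fin D,
      ∑ s, t g s * A s (g' 0 0) (g' 1 0) (g' 0 1) (g' 1 1) =
        (Fintype.card G : ℂ)⁻¹ *
          ∑ k : G, (fun (g g' : Fin 2 → Fin 2 → Fin D) => ∏ i : Fin 2, ∏ s : Fin 2,
            (![fun a b => star ((((U k : Matrix.unitaryGroup (Fin D) ℂ) : Matrix (Fin D) (Fin D) ℂ)) a b),
              fun a b => (((U k : Matrix.unitaryGroup (Fin D) ℂ) : Matrix (Fin D) (Fin D) ℂ)) a b] :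
              Fin 2 → Fin D → Fin D → ℂ) s (g i s) (g' i s)) g g')
    (ψ : TensorIndex (TorusSite 2 L) q → ℂ)
    (hψ : ∀ (x : TorusSite 2 L) (σ : TensorIndex (TorusSite 2 L) q), ∃ X : PEPSBoundary D 2 2,
      ∀ β : torusBlock L 2 2 x → Fin q,
        ψ (Subtype.val.extend β σ) = pepsRect 2 2 A X (fun p => β (torusBlockElem L 2 2 x p))) :
    ∃ c : (TorusSite 2 L × Fin 2 → G) → ℂ,
      (∀ κ : TorusSite 2 L × Fin 2 → G,
        (∃ x : TorusSite 2 L, κ (x, 0) * κ (x + torusUnit L 0, 1) ≠ κ (x, 1) * κ (x + torusUnit L 1, 0)) →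
          c κ = 0) ∧
      ∀ G₁ : TorusSite 2 L → Fin 2 → Fin 2 → Fin D,
        (∑ σ : TensorIndex (TorusSite 2 L) q, (∏ y, t (G₁ y) (σ y)) * ψ σ) =
          ∑ κ : TorusSite 2 L × Fin 2 → G, c κ *
            ∏ b : TorusSite 2 L × Fin 2,
              ((U (κ b) : Matrix.unitaryGroup (Fin D) ℂ) : Matrix (Fin D) (Fin D) ℂ)
                (G₁ b.1 b.2 1) (G₁ (b.1 + torusUnit L b.2) b.2 0) := by
  classical
  -- dual functionals
  obtain ⟨d, hd⟩ := exists_dual_of_isSemiregularRep U hU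
  let u : G → (Fin 2 → Fin D) → ℂ := fun k m =>
    ((U k : Matrix.unitaryGroup (Fin D) ℂ) : Matrix (Fin D) (Fin D) ℂ) (m 0) (m 1)
  let d' : G → (Fin 2 → Fin D) → ℂ := fun k m => d k (m 0) (m 1)
  have hd' : ∀ k h : G, ∑ m, d' k m * u h m = if k = h then 1 else 0 := by
    intro k h
    rw [← hd k h, ← (finTwoArrowEquiv (Fin D)).symm.sum_comp]
    simp only [Fintype.sum_prod_type]
    rfl
  -- the inner bonds of the block at `x`, the local gauge forms
  set Sx : TorusSite 2 L → Finset (TorusSite 2 L × Fin 2) := fun x =>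
    (Finset.univ : Finset (Fin 2 × Fin 2)).image fun ic =>
      (torusBlockSite L 2 2 x (![((0 : Fin 2), ic.2), (ic.2, 0)] ic.1), ic.1) with hSx_def
  have hSx : ∀ (x : TorusSite 2 L) (b : TorusSite 2 L × Fin 2), b ∈ Sx x ↔
      ∃ i c : Fin 2, b = (torusBlockSite L 2 2 x (![((0 : Fin 2), c), (c, 0)] i), i) := by
    intro x b
    simp only [hSx_def, Finset.mem_image, Finset.mem_univ, true_and, Prod.exists]
    exact ⟨fun ⟨i, c, h⟩ => ⟨i, c, h.symm⟩, fun ⟨i, c, h⟩ => ⟨i, c, h.symm⟩⟩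
  choose T' hT'0 hT'inv hT'form using fun x : TorusSite 2 L =>
    virtualT_localGaugeForm L hL hq U A t ht x ψ (hψ x) (hSx x)
  -- bond coordinates
  let toSite : (TorusSite 2 L × Fin 2 → Fin 2 → Fin D) → TorusSite 2 L → Fin 2 → Fin 2 → Fin D :=
    fun H y i s => (![H (y - torusUnit L i, i) 1, H (y, i) 0] : Fin 2 → Fin D) s
  let Φb : (TorusSite 2 L × Fin 2 → Fin 2 → Fin D) → ℂ := fun H =>
    ∑ σ : TensorIndex (TorusSite 2 L) q, (∏ y, t (toSite H y) (σ y)) * ψ σ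
  let bnd : TorusSite 2 L → Fin 2 × Fin 2 → TorusSite 2 L × Fin 2 := fun x j =>
    (torusBlockSite L 2 2 x (![((0 : Fin 2), j.2), (j.2, 0)] j.1), j.1)
  have hbnd : ∀ x, Function.Injective (bnd x) := fun x => innerBond_injective hL x
  have hbnd_mem : ∀ x j, bnd x j ∈ Sx x := fun x j => (hSx x _).2 ⟨j.1, j.2, rfl⟩
  let Tb : TorusSite 2 L → (Fin 2 × Fin 2 → G) → (TorusSite 2 L × Fin 2 → Fin 2 → Fin D) → ℂ :=
    fun x κ H => T' x (fun i c => κ (i, c)) (toSite H)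
  let flat : (Fin 2 × Fin 2 → G) → Prop := fun κ => κ (0, 0) * κ (1, 1) = κ (1, 0) * κ (0, 1)
  -- the leg read by `toSite` at `(y, i, s)` sits on the bond `(![y - e_i, y] s, i)`
  have htoSite_read : ∀ (K : TorusSite 2 L × Fin 2 → Fin 2 → Fin D) (y : TorusSite 2 L)
      (i s : Fin 2), toSite K y i s = K (![y - torusUnit L i, y] s, i) ((![1, 0] : Fin 2 → Fin 2) s) := by
    intro K y i s
    fin_cases s <;> simp [toSite]
  have htoSite_update : ∀ (H : TorusSite 2 L × Fin 2 → Fin 2 → Fin D) (b : TorusSite 2 L × Fin 2)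
      (m : Fin 2 → Fin D) (y : TorusSite 2 L) (i s : Fin 2), (![y - torusUnit L i, y] s, i) ≠ b →
      toSite (Function.update H b m) y i s = toSite H y i s := by
    intro H b m y i s hne
    rw [htoSite_read, htoSite_read, Function.update_of_ne hne]
  have hplaq : ∀ (x : TorusSite 2 L) (H : TorusSite 2 L × Fin 2 → Fin 2 → Fin D),
      Φb H = ∑ κ : Fin 2 × Fin 2 → G, (∏ j, u (κ j) (H (bnd x j))) * Tb x κ H := by
    intro x H
    simp only [Φb]
    rw [hT'form x (toSite H), ← (Equiv.curry (Fin 2) (Fin 2) G).sum_comp]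
    refine Finset.sum_congr rfl fun κ _ => ?_
    simp only [Tb, u, bnd, Equiv.curry_apply, Function.curry, Fintype.prod_prod_type' (f := fun i c =>
      ((U (κ (i, c)) : Matrix.unitaryGroup (Fin D) ℂ) : Matrix (Fin D) (Fin D) ℂ)
        (H (torusBlockSite L 2 2 x (![((0 : Fin 2), c), (c, 0)] i), i) 0)
        (H (torusBlockSite L 2 2 x (![((0 : Fin 2), c), (c, 0)] i), i) 1))]
    congr 1
    refine Finset.prod_congr rfl fun i _ => Finset.prod_congr rfl fun c _ => ?_
    simp only [toSite, Matrix.cons_val_zero, Matrix.cons_val_one, Matrix.cons_val_fin_one,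
      torusBlockSite_innerFar_sub_unit]
  have hTb : ∀ (x : TorusSite 2 L) (κ : Fin 2 × Fin 2 → G) (j : Fin 2 × Fin 2)
      (H : TorusSite 2 L × Fin 2 → Fin 2 → Fin D) (m : Fin 2 → Fin D),
      Tb x κ (Function.update H (bnd x j) m) = Tb x κ H := by
    intro x κ j H m
    simp only [Tb]
    refine hT'inv x _ _ _ fun y i s hyis => htoSite_update H (bnd x j) m y i s fun h => hyis ?_
    rw [h]
    exact hbnd_mem x j
  have hTb0 : ∀ (x : TorusSite 2 L) (κ : Fin 2 × Fin 2 → G), ¬ flat κ → Tb x κ = 0 := by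
    intro x κ hκ
    funext H
    simp only [Tb]
    rw [hT'0 x (fun i c => κ (i, c)) hκ]
    rfl
  -- single-bond forms and the bond projections
  have hfix : ∀ (b : TorusSite 2 L × Fin 2) (H : TorusSite 2 L × Fin 2 → Fin 2 → Fin D),
      ∑ m, (∑ k, u k (H b) * d' k m) * Φb (Function.update H b m) = Φb H := by
    intro b H
    have hb : bnd b.1 (b.2, 0) = b := by
      obtain ⟨z, i⟩ := b
      simp only [bnd]
      have h0 : (![((0 : Fin 2), (0 : Fin 2)), (0, 0)] i) = (0, 0) := by fin_cases i <;> rfl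
      rw [h0, torusBlockSite_zero_zero L 1 1 z]
    obtain ⟨Rk, h1, h2⟩ := bondExp_localForm_of_plaquette u Φb (bnd b.1) (hbnd b.1) (Tb b.1)
      (hplaq b.1) (hTb b.1) (b.2, 0)
    rw [hb] at h1 h2
    exact bondExp_fix_of_localForm u d' hd' Φb b Rk h1 h2 H
  refine ⟨fun κ => ∑ H' : TorusSite 2 L × Fin 2 → Fin 2 → Fin D, (∏ b, d' (κ b) (H' b)) * Φb H',
    fun κ ⟨x, hx⟩ => ?_, fun G₁ => ?_⟩
  · -- non-flat configurations have vanishing coefficient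
    refine bondExp_coeff_eq_zero u d' hd' Φb (bnd x) (hbnd x) (Tb x) flat (hplaq x) (hTb x) (hTb0 x)
      κ fun hflat => hx ?_
    have h00 : bnd x (0, 0) = (x, 0) := by
      simp only [bnd]
      rw [show (![((0 : Fin 2), (0 : Fin 2)), (0, 0)] (0 : Fin 2)) = (0, 0) from rfl,
        torusBlockSite_zero_zero L 1 1 x]
    have h10 : bnd x (1, 0) = (x, 1) := by
      simp only [bnd]
      rw [show (![((0 : Fin 2), (0 : Fin 2)), (0, 0)] (1 : Fin 2)) = (0, 0) from rfl,
        torusBlockSite_zero_zero L 1 1 x]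
    have h11 : bnd x (1, 1) = (x + torusUnit L 0, 1) := by
      simp only [bnd]
      rw [show (![((0 : Fin 2), (1 : Fin 2)), (1, 0)] (1 : Fin 2)) = (1, 0) from rfl,
        ← torusBlockSite_unit L x 0]
      rfl
    have h01 : bnd x (0, 1) = (x + torusUnit L 1, 0) := by
      simp only [bnd]
      rw [show (![((0 : Fin 2), (1 : Fin 2)), (1, 0)] (0 : Fin 2)) = (0, 1) from rfl,
        ← torusBlockSite_unit L x 1]
      rfl
    simp only [flat, Function.comp_apply, h00, h10, h11, h01] at hflat
    exact hflat
  · -- the expansion, read back in leg coordinates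
    let toBond : (TorusSite 2 L → Fin 2 → Fin 2 → Fin D) → TorusSite 2 L × Fin 2 → Fin 2 → Fin D :=
      fun G₁ b => (![G₁ b.1 b.2 1, G₁ (b.1 + torusUnit L b.2) b.2 0] : Fin 2 → Fin D)
    have hG₁ : toSite (toBond G₁) = G₁ := toSite_toBond G₁
    have hexp := bondExp_expand u d' Φb hfix (toBond G₁)
    simp only [Φb, hG₁] at hexp
    rw [hexp]
    refine Finset.sum_congr rfl fun κ _ => ?_
    rw [mul_comm]
    rfl


/-! ### Flat bond configurations on the torus are gauge transforms of the `(g,h)`-closures -/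

/-- **Discrete holonomy on the torus.** A configuration `κ : bonds → G` on the `L × L` torus that is
flat on every plaquette (`κ(x,0) κ(x+e₀,1) = κ(x,1) κ(x+e₁,0)`) is a gauge transform of a
closure configuration: there are `γ : sites → G` and a **commuting** pair `(g, h)` with
`κ(z,i) = γ_z · ω_{g,h}(z,i) · γ_{z+e_i}⁻¹`, where `ω_{g,h}` is `g` on the horizontal bonds leaving
the column `-1`, `h` on the vertical bonds leaving the row `-1`, and `1` elsewhere. (`γ_z⁻¹` is the
parallel transport of `κ` from the origin along row `0` and then down the column of `z`; `g`, `h`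
are the holonomies of the two fundamental loops, which commute because the transport around the
whole torus can be computed rows-first or columns-first.) This is the combinatorial content of
Schuch–Cirac–Pérez-García (2010) Thm. 5.5 / §5.2 ("strings of `g`'s and `h`'s can be deformed
freely … the constraint `v₂h₁ = h₂v₁` gives `gh = hg`"). [cite: SchuchCiracPerezGarcia2010, Thm. 5.5] -/
theorem exists_gauge_of_flat {L : ℕ} [NeZero L] {G : Type*} [Group G]
    (κ : TorusSite 2 L × Fin 2 → G)
    (hflat : ∀ x : TorusSite 2 L,
      κ (x, 0) * κ (x + torusUnit L 0, 1) = κ (x, 1) * κ (x + torusUnit L 1, 0)) :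
    ∃ (γ : TorusSite 2 L → G) (g h : G), g * h = h * g ∧
      ∀ (z : TorusSite 2 L) (i : Fin 2),
        κ (z, i) = γ z * (if z i = -1 then (![g, h] : Fin 2 → G) i else 1) *
          (γ (z + torusUnit L i))⁻¹ := by
  have hL1 : 1 ≤ L := Nat.one_le_iff_ne_zero.2 (NeZero.ne L)
  -- natural coordinates
  let site : ℕ → ℕ → TorusSite 2 L := fun a b => ![((a : ℕ) : ZMod L), ((b : ℕ) : ZMod L)]
  have hsite0 : ∀ a b : ℕ, site a b + torusUnit L 0 = site (a + 1) b := by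
    intro a b
    unfold torusUnit
    ext j
    fin_cases j <;> simp [site]
  have hsite1 : ∀ a b : ℕ, site a b + torusUnit L 1 = site a (b + 1) := by
    intro a b
    unfold torusUnit
    ext j
    fin_cases j <;> simp [site]
  have hsiteL0 : ∀ b : ℕ, site L b = site 0 b := by
    intro b
    simp [site]
  have hsiteL1 : ∀ a : ℕ, site a L = site a 0 := by
    intro a
    simp [site]
  have hflat' : ∀ a b : ℕ,
      κ (site a b, 0) * κ (site (a + 1) b, 1) = κ (site a b, 1) * κ (site a (b + 1), 0) := by
    intro a b
    rw [← hsite0, ← hsite1]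
    exact hflat _
  -- parallel transport from the origin: along row `0`, then down the column
  let Ph : ℕ → G := fun a => ((List.range a).map fun j => κ (site j 0, 0)).prod
  let Pv : ℕ → ℕ → G := fun a b => ((List.range b).map fun j => κ (site a j, 1)).prod
  obtain ⟨μ, hμ⟩ : ∃ μ : ℕ → ℕ → G, μ = fun a b => Ph a * Pv a b := ⟨_, rfl⟩
  have hPh : ∀ a, Ph (a + 1) = Ph a * κ (site a 0, 0) := by
    intro a
    simp only [Ph]
    rw [List.range_succ, List.map_append, List.prod_append, List.map_singleton, List.prod_singleton]
  have hPv : ∀ a b, Pv a (b + 1) = Pv a b * κ (site a b, 1) := by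
    intro a b
    simp only [Pv]
    rw [List.range_succ, List.map_append, List.prod_append, List.map_singleton, List.prod_singleton]
  have hμ00 : μ 0 0 = 1 := by simp [hμ, Ph, Pv]
  have I1 : ∀ a b, μ a (b + 1) = μ a b * κ (site a b, 1) := by
    intro a b
    simp only [hμ, hPv, mul_assoc]
  have I2 : ∀ b a, μ (a + 1) b = μ a b * κ (site a b, 0) := by
    intro b
    induction b with
    | zero =>
      intro a
      simp only [hμ, Pv, List.range_zero, List.map_nil, List.prod_nil, mul_one, hPh]
    | succ b ih =>
      intro a
      rw [I1, ih, I1, mul_assoc, mul_assoc, hflat']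
  -- the two holonomies
  set g : G := μ L 0 with hg
  set h : G := μ 0 L with hh
  have I3 : ∀ b, μ L b = g * μ 0 b := by
    intro b
    induction b with
    | zero => rw [hμ00, mul_one]
    | succ b ih => rw [I1, ih, I1, hsiteL0, mul_assoc]
  have I4 : ∀ a, μ a L = h * μ a 0 := by
    intro a
    induction a with
    | zero => rw [hμ00, mul_one]
    | succ a ih => rw [I2, ih, I2, hsiteL1, mul_assoc]
  have I5 : g * h = h * g := by
    have h1 : μ L L = g * h := I3 L
    have h2 : μ L L = h * g := I4 L
    rw [← h1, h2]
  -- coordinates of a site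
  have hz : ∀ z : TorusSite 2 L, z = site (z 0).val (z 1).val := by
    intro z
    ext j
    fin_cases j <;> simp [site]
  have hval : ∀ a : ℕ, a < L → (((a : ℕ) : ZMod L)).val = a := fun a ha => ZMod.val_cast_of_lt ha
  have hneg1 : ((L - 1 : ℕ) : ZMod L) = -1 := by
    rw [Nat.cast_sub hL1, ZMod.natCast_self, Nat.cast_one, zero_sub]
  have hseam : ∀ a : ℕ, a < L → ((((a : ℕ) : ZMod L)) = -1 ↔ a + 1 = L) := by
    intro a ha
    rw [← hneg1]
    constructor
    · intro h1
      have h2 := congrArg ZMod.val h1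
      rw [hval a ha, hval (L - 1) (by omega)] at h2
      omega
    · intro h1
      rw [show a = L - 1 by omega]
  refine ⟨fun z => (μ (z 0).val (z 1).val)⁻¹, g, h, I5, fun z i => ?_⟩
  set a := (z 0).val with ha
  set b := (z 1).val with hb
  have haL : a < L := ZMod.val_lt _
  have hbL : b < L := ZMod.val_lt _
  have hz' : z = site a b := hz z
  fin_cases i
  · -- horizontal bond
    simp only [Fin.zero_eta, Fin.isValue, Matrix.cons_val_zero]
    rw [hz', hsite0]
    have hz0 : site a b 0 = ((a : ℕ) : ZMod L) := rfl
    rw [hz0]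
    by_cases hA : a + 1 = L
    · rw [if_pos ((hseam a haL).2 hA), hA, hsiteL0]
      have h1 : site 0 b 0 = ((0 : ℕ) : ZMod L) := rfl
      have h2 : site 0 b 1 = ((b : ℕ) : ZMod L) := rfl
      have h3 : site a b 1 = ((b : ℕ) : ZMod L) := rfl
      simp only [h1, h2, h3, hval a haL, hval b hbL, hval 0 (by omega)]
      have key : μ L b = μ a b * κ (site a b, 0) := by rw [← I2, hA]
      rw [I3] at key
      rw [inv_inv, mul_assoc, key, inv_mul_cancel_left]
    · have hA' : a + 1 < L := by omega
      rw [if_neg (fun h => hA ((hseam a haL).1 h)), mul_one]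
      have h1 : site (a + 1) b 0 = ((a + 1 : ℕ) : ZMod L) := rfl
      have h2 : site (a + 1) b 1 = ((b : ℕ) : ZMod L) := rfl
      have h3 : site a b 1 = ((b : ℕ) : ZMod L) := rfl
      simp only [h1, h2, h3, hval a haL, hval b hbL, hval (a + 1) hA']
      rw [inv_inv, I2, inv_mul_cancel_left]
  · -- vertical bond
    simp only [Fin.mk_one, Fin.isValue, Matrix.cons_val_one, Matrix.cons_val_fin_one]
    rw [hz', hsite1]
    have hz1 : site a b 1 = ((b : ℕ) : ZMod L) := rfl
    rw [hz1]
    by_cases hB : b + 1 = L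
    · rw [if_pos ((hseam b hbL).2 hB), hB, hsiteL1]
      have h1 : site a 0 1 = ((0 : ℕ) : ZMod L) := rfl
      have h2 : site a 0 0 = ((a : ℕ) : ZMod L) := rfl
      have h3 : site a b 0 = ((a : ℕ) : ZMod L) := rfl
      simp only [h1, h2, h3, hval a haL, hval b hbL, hval 0 (by omega)]
      have key : μ a L = μ a b * κ (site a b, 1) := by rw [← I1, hB]
      rw [I4] at key
      rw [inv_inv, mul_assoc, key, inv_mul_cancel_left]
    · have hB' : b + 1 < L := by omega
      rw [if_neg (fun h => hB ((hseam b hbL).1 h)), mul_one]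
      have h1 : site a (b + 1) 1 = ((b + 1 : ℕ) : ZMod L) := rfl
      have h2 : site a (b + 1) 0 = ((a : ℕ) : ZMod L) := rfl
      have h3 : site a b 0 = ((a : ℕ) : ZMod L) := rfl
      simp only [h1, h2, h3, hval a haL, hval b hbL, hval (b + 1) hB']
      rw [inv_inv, I1, inv_mul_cancel_left]


/-- **Legs regrouped by bonds**: a product over all legs `(y, i, s)` of the torus is the product
over the bonds `(z, i)` of the factors of its two legs `(z, i, 1)` and `(z + e_i, i, 0)`. [folklore] -/
theorem prod_legs_eq_prod_bonds {L : ℕ} [NeZero L] {M : Type*} [CommMonoid M]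
    (f : TorusSite 2 L → Fin 2 → Fin 2 → M) :
    ∏ y : TorusSite 2 L, ∏ i : Fin 2, ∏ s : Fin 2, f y i s =
      ∏ b : TorusSite 2 L × Fin 2, f b.1 b.2 1 * f (b.1 + torusUnit L b.2) b.2 0 := by
  simp only [Fintype.prod_prod_type, Fin.prod_univ_two, Finset.prod_mul_distrib]
  -- reindex the incoming legs by the bond they belong to: `z ↦ z + e_i`
  rw [Fintype.prod_equiv (Equiv.addRight (torusUnit L 0)) (fun y => f (y + torusUnit L 0) 0 0)
      (fun y => f y 0 0) (fun y => rfl),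
    Fintype.prod_equiv (Equiv.addRight (torusUnit L 1)) (fun y => f (y + torusUnit L 1) 1 0)
      (fun y => f y 1 0) (fun y => rfl)]
  exact mul_comm _ _

/-- The single-bond contraction `Σ_{c,c'} V(a,c) X̄(a',c') W(c,c') = (V W X†)(a,a')`. [folklore] -/
theorem sum_sum_mul_star_mul_eq_mul_mul_conjTranspose (V W X : Matrix (Fin D) (Fin D) ℂ) (a a' : Fin D) :
    ∑ c, ∑ c', V a c * star (X a' c') * W c c' = (V * W * Xᴴ) a a' := by
  simp only [Matrix.mul_apply, Matrix.conjTranspose_apply, Finset.sum_mul]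
  rw [Finset.sum_comm]
  refine Finset.sum_congr rfl fun c' _ => Finset.sum_congr rfl fun c _ => ?_
  ring

/-- **Gauge transformations act on bond tensors by conjugation on every bond**: applying
`⊗_y ρ(U_{γ_y})` to the bond tensor `⊗_{(z,i)} U_{ω(z,i)}` gives the bond tensor of
`(z,i) ↦ γ_z ω(z,i) γ_{z+e_i}⁻¹` (`U_{γ_z} U_ω U_{γ_{z+e_i}}†` bond by bond). This is the virtual-level
form of moving strings of `U_g`'s with the `G`-invariance, Schuch–Cirac–Pérez-García (2010) §5.2,
eq. (34). [cite: SchuchCiracPerezGarcia2010, Thm. 5.5] -/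
theorem gauge_bondTensor {L : ℕ} [NeZero L] {G : Type*} [Group G]
    (U : G →* Matrix.unitaryGroup (Fin D) ℂ) (γ : TorusSite 2 L → G) (ω : TorusSite 2 L × Fin 2 → G)
    (G₁ : TorusSite 2 L → Fin 2 → Fin 2 → Fin D) :
    ∑ G' : TorusSite 2 L → Fin 2 → Fin 2 → Fin D,
        (∏ y, (fun (g g' : Fin 2 → Fin 2 → Fin D) => ∏ i : Fin 2, ∏ s : Fin 2,
          (![fun a b => star ((((U (γ y) : Matrix.unitaryGroup (Fin D) ℂ) : Matrix (Fin D) (Fin D) ℂ)) a b),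
            fun a b => (((U (γ y) : Matrix.unitaryGroup (Fin D) ℂ) : Matrix (Fin D) (Fin D) ℂ)) a b] :
            Fin 2 → Fin D → Fin D → ℂ) s (g i s) (g' i s)) (G₁ y) (G' y)) *
          ∏ b : TorusSite 2 L × Fin 2,
            ((U (ω b) : Matrix.unitaryGroup (Fin D) ℂ) : Matrix (Fin D) (Fin D) ℂ)
              (G' b.1 b.2 1) (G' (b.1 + torusUnit L b.2) b.2 0) =
      ∏ b : TorusSite 2 L × Fin 2,
        ((U (γ b.1 * ω b * (γ (b.1 + torusUnit L b.2))⁻¹) : Matrix.unitaryGroup (Fin D) ℂ) :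
            Matrix (Fin D) (Fin D) ℂ) (G₁ b.1 b.2 1) (G₁ (b.1 + torusUnit L b.2) b.2 0) := by
  -- Step 1: the gauge kernel regrouped by bonds
  have hρ : ∀ G' : TorusSite 2 L → Fin 2 → Fin 2 → Fin D,
      (∏ y, (fun (g g' : Fin 2 → Fin 2 → Fin D) => ∏ i : Fin 2, ∏ s : Fin 2,
          (![fun a b => star ((((U (γ y) : Matrix.unitaryGroup (Fin D) ℂ) : Matrix (Fin D) (Fin D) ℂ)) a b),
            fun a b => (((U (γ y) : Matrix.unitaryGroup (Fin D) ℂ) : Matrix (Fin D) (Fin D) ℂ)) a b] :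
            Fin 2 → Fin D → Fin D → ℂ) s (g i s) (g' i s)) (G₁ y) (G' y)) =
        ∏ b : TorusSite 2 L × Fin 2,
          (((U (γ b.1) : Matrix.unitaryGroup (Fin D) ℂ) : Matrix (Fin D) (Fin D) ℂ) (G₁ b.1 b.2 1) (G' b.1 b.2 1) *
            star (((U (γ (b.1 + torusUnit L b.2)) : Matrix.unitaryGroup (Fin D) ℂ) : Matrix (Fin D) (Fin D) ℂ)
              (G₁ (b.1 + torusUnit L b.2) b.2 0) (G' (b.1 + torusUnit L b.2) b.2 0))) := by
    intro G'
    exact prod_legs_eq_prod_bonds (fun y i s =>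
      (![fun a b => star ((((U (γ y) : Matrix.unitaryGroup (Fin D) ℂ) : Matrix (Fin D) (Fin D) ℂ)) a b),
        fun a b => (((U (γ y) : Matrix.unitaryGroup (Fin D) ℂ) : Matrix (Fin D) (Fin D) ℂ)) a b] :
        Fin 2 → Fin D → Fin D → ℂ) s (G₁ y i s) (G' y i s))
  simp only [hρ, ← Finset.prod_mul_distrib]
  -- Step 2: bond coordinates, and the sum factorises over the bonds
  let e : (TorusSite 2 L × Fin 2 → Fin 2 → Fin D) ≃ (TorusSite 2 L → Fin 2 → Fin 2 → Fin D) :=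
    { toFun := fun H y i s => (![H (y - torusUnit L i, i) 1, H (y, i) 0] : Fin 2 → Fin D) s
      invFun := fun G' b => (![G' b.1 b.2 1, G' (b.1 + torusUnit L b.2) b.2 0] : Fin 2 → Fin D)
      left_inv := fun H => toBond_toSite H
      right_inv := fun G' => toSite_toBond G' }
  rw [← e.sum_comp]
  have he : ∀ (H : TorusSite 2 L × Fin 2 → Fin 2 → Fin D) (b : TorusSite 2 L × Fin 2),
      e H b.1 b.2 1 = H b 0 ∧ e H (b.1 + torusUnit L b.2) b.2 0 = H b 1 := by
    intro H b
    simp [e]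
  simp only [(he _ _).1, (he _ _).2]
  rw [← Fintype.prod_sum (fun (b : TorusSite 2 L × Fin 2) (m : Fin 2 → Fin D) =>
    (((U (γ b.1) : Matrix.unitaryGroup (Fin D) ℂ) : Matrix (Fin D) (Fin D) ℂ) (G₁ b.1 b.2 1) (m 0) *
      star (((U (γ (b.1 + torusUnit L b.2)) : Matrix.unitaryGroup (Fin D) ℂ) : Matrix (Fin D) (Fin D) ℂ)
        (G₁ (b.1 + torusUnit L b.2) b.2 0) (m 1))) *
      ((U (ω b) : Matrix.unitaryGroup (Fin D) ℂ) : Matrix (Fin D) (Fin D) ℂ) (m 0) (m 1))]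
  refine Finset.prod_congr rfl fun b _ => ?_
  -- Step 3: the single-bond computation `Σ_{c,c'} U_γ(a,c) U_ω(c,c') Ū_{γ'}(a',c') = (U_γ U_ω U_{γ'}†)(a,a')`
  rw [← (finTwoArrowEquiv (Fin D)).symm.sum_comp, Fintype.sum_prod_type]
  simp only [finTwoArrowEquiv_symm_apply, Matrix.cons_val_zero, Matrix.cons_val_one]
  have hM : ((U (γ b.1) : Matrix.unitaryGroup (Fin D) ℂ) : Matrix (Fin D) (Fin D) ℂ) *
      ((U (ω b) : Matrix.unitaryGroup (Fin D) ℂ) : Matrix (Fin D) (Fin D) ℂ) *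
        (((U (γ (b.1 + torusUnit L b.2)) : Matrix.unitaryGroup (Fin D) ℂ) : Matrix (Fin D) (Fin D) ℂ))ᴴ =
      ((U (γ b.1 * ω b * (γ (b.1 + torusUnit L b.2))⁻¹) : Matrix.unitaryGroup (Fin D) ℂ) :
        Matrix (Fin D) (Fin D) ℂ) := by
    rw [← unitaryRep_mul_conjTranspose U, map_mul]
    rfl
  rw [sum_sum_mul_star_mul_eq_mul_mul_conjTranspose]
  exact congrFun (congrFun hM _) _


/-- `gauge_bondTensor` for the closure configuration `ω_{g,h}(z,i) = [z_i = -1] (g,h)_i`, written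
out. [cite: SchuchCiracPerezGarcia2010, Thm. 5.5] -/
theorem gauge_closureTensor {L : ℕ} [NeZero L] {G : Type*} [Group G]
    (U : G →* Matrix.unitaryGroup (Fin D) ℂ) (γ : TorusSite 2 L → G) (g h : G)
    (G₁ : TorusSite 2 L → Fin 2 → Fin 2 → Fin D) :
    ∑ G' : TorusSite 2 L → Fin 2 → Fin 2 → Fin D,
        (∏ y, (fun (g g' : Fin 2 → Fin 2 → Fin D) => ∏ i : Fin 2, ∏ s : Fin 2,
          (![fun a b => star ((((U (γ y) : Matrix.unitaryGroup (Fin D) ℂ) : Matrix (Fin D) (Fin D) ℂ)) a b),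
            fun a b => (((U (γ y) : Matrix.unitaryGroup (Fin D) ℂ) : Matrix (Fin D) (Fin D) ℂ)) a b] :
            Fin 2 → Fin D → Fin D → ℂ) s (g i s) (g' i s)) (G₁ y) (G' y)) *
          ∏ b : TorusSite 2 L × Fin 2,
            ((U (if b.1 b.2 = -1 then (![g, h] : Fin 2 → G) b.2 else 1) : Matrix.unitaryGroup (Fin D) ℂ) :
                Matrix (Fin D) (Fin D) ℂ) (G' b.1 b.2 1) (G' (b.1 + torusUnit L b.2) b.2 0) =
      ∏ b : TorusSite 2 L × Fin 2,
        ((U (γ b.1 * (if b.1 b.2 = -1 then (![g, h] : Fin 2 → G) b.2 else 1) *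
              (γ (b.1 + torusUnit L b.2))⁻¹) : Matrix.unitaryGroup (Fin D) ℂ) :
            Matrix (Fin D) (Fin D) ℂ) (G₁ b.1 b.2 1) (G₁ (b.1 + torusUnit L b.2) b.2 0) :=
  gauge_bondTensor U γ (fun b => if b.1 b.2 = -1 then (![g, h] : Fin 2 → G) b.2 else 1) G₁

/-! ### The `(g,h)`-closed PEPS: closure tensors as bond tensors, frustration-freeness -/

/-- **The closure tensor `Ω_{U_g,U_h}` is the bond tensor of the closure configuration**
`ω_{g,h}(z,i) = [z_i = -1] · (g, h)_i`: `seamWeight (U_g)` is `U_g` on the seam and `δ = U_1` off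
it. Schuch–Cirac–Pérez-García (2010) Def. 5.6. [cite: SchuchCiracPerezGarcia2010, Def. 5.6] -/
theorem prod_seamWeight_eq_bondTensor {L : ℕ} [NeZero L] {G : Type*} [Group G]
    (U : G →* Matrix.unitaryGroup (Fin D) ℂ) (g h : G) (G₁ : TorusSite 2 L → Fin 2 → Fin 2 → Fin D) :
    ∏ z : TorusSite 2 L,
        (seamWeight ((U g : Matrix.unitaryGroup (Fin D) ℂ) : Matrix (Fin D) (Fin D) ℂ) (z 0 = -1)
            (G₁ z 0 1) (G₁ (z + torusUnit L 0) 0 0) *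
          seamWeight ((U h : Matrix.unitaryGroup (Fin D) ℂ) : Matrix (Fin D) (Fin D) ℂ) (z 1 = -1)
            (G₁ z 1 1) (G₁ (z + torusUnit L 1) 1 0)) =
      ∏ b : TorusSite 2 L × Fin 2,
        ((U (if b.1 b.2 = -1 then (![g, h] : Fin 2 → G) b.2 else 1) : Matrix.unitaryGroup (Fin D) ℂ) :
            Matrix (Fin D) (Fin D) ℂ) (G₁ b.1 b.2 1) (G₁ (b.1 + torusUnit L b.2) b.2 0) := by
  have hsw : ∀ (k : G) (P : Prop) [Decidable P] (a b : Fin D),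
      seamWeight ((U k : Matrix.unitaryGroup (Fin D) ℂ) : Matrix (Fin D) (Fin D) ℂ) P a b =
        ((U (if P then k else 1) : Matrix.unitaryGroup (Fin D) ℂ) : Matrix (Fin D) (Fin D) ℂ) a b := by
    intro k P _ a b
    by_cases hP : P
    · simp [seamWeight, hP]
    · simp [seamWeight, hP, Matrix.one_apply]
  rw [Fintype.prod_prod_type]
  refine Finset.prod_congr rfl fun z _ => ?_
  rw [Fin.prod_univ_two, hsw, hsw]
  rfl

/-- **Bond tensors trivial on `S` lie in `V_S`.** The bond tensor `⊗_b U_{κ_b}` of a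
configuration with `κ_b = 1` for `b ∈ S` vanishes off the `S`-matched leg configurations and is
invariant under matched changes of the legs of `S` (on `S` its factors are `δ`'s, and every other
factor only sees the legs of its own bond). [folklore] -/
theorem bondTensor_mem_bondSpace {L : ℕ} [NeZero L] {G : Type*} [Group G]
    (U : G →* Matrix.unitaryGroup (Fin D) ℂ) (κ : TorusSite 2 L × Fin 2 → G)
    (S : Finset (TorusSite 2 L × Fin 2)) (hκ : ∀ b ∈ S, κ b = 1) :
    (∀ G₁ : TorusSite 2 L → Fin 2 → Fin 2 → Fin D,
      (∃ b ∈ S, G₁ b.1 b.2 1 ≠ G₁ (b.1 + torusUnit L b.2) b.2 0) →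
      (∏ b : TorusSite 2 L × Fin 2,
        ((U (κ b) : Matrix.unitaryGroup (Fin D) ℂ) : Matrix (Fin D) (Fin D) ℂ)
          (G₁ b.1 b.2 1) (G₁ (b.1 + torusUnit L b.2) b.2 0)) = 0) ∧
    (∀ G₁ G₂ : TorusSite 2 L → Fin 2 → Fin 2 → Fin D,
      (∀ b ∈ S, G₁ b.1 b.2 1 = G₁ (b.1 + torusUnit L b.2) b.2 0) →
      (∀ b ∈ S, G₂ b.1 b.2 1 = G₂ (b.1 + torusUnit L b.2) b.2 0) →
      (∀ y i s, (![y - torusUnit L i, y] s, i) ∉ S → G₁ y i s = G₂ y i s) →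
      (∏ b : TorusSite 2 L × Fin 2,
        ((U (κ b) : Matrix.unitaryGroup (Fin D) ℂ) : Matrix (Fin D) (Fin D) ℂ)
          (G₁ b.1 b.2 1) (G₁ (b.1 + torusUnit L b.2) b.2 0)) =
      ∏ b : TorusSite 2 L × Fin 2,
        ((U (κ b) : Matrix.unitaryGroup (Fin D) ℂ) : Matrix (Fin D) (Fin D) ℂ)
          (G₂ b.1 b.2 1) (G₂ (b.1 + torusUnit L b.2) b.2 0)) := by
  classical
  refine ⟨fun G₁ ⟨b, hb, hne⟩ => ?_, fun G₁ G₂ hG₁ hG₂ hGG => ?_⟩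
  · refine Finset.prod_eq_zero (Finset.mem_univ b) ?_
    rw [hκ b hb, map_one]
    simp [hne]
  · refine Finset.prod_congr rfl fun b _ => ?_
    by_cases hb : b ∈ S
    · rw [hκ b hb, map_one]
      simp [hG₁ b hb, hG₂ b hb]
    · have h1 : G₁ b.1 b.2 1 = G₂ b.1 b.2 1 := hGG b.1 b.2 1 (by simpa using hb)
      have h0 : G₁ (b.1 + torusUnit L b.2) b.2 0 = G₂ (b.1 + torusUnit L b.2) b.2 0 :=
        hGG (b.1 + torusUnit L b.2) b.2 0 (by simpa using hb)
      rw [h1, h0]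

/-- **Moving both closure loops off a `2 × 2` block** (Schuch–Cirac–Pérez-García (2010) §5.2,
eq. (34): "we can move the loops anywhere we want on the torus", using `gh = hg`). For a commuting
pair `(g, h)` and the block anchored at `x`, the gauge transformation
`γ_z = g^{[x₀ = -1 ∧ z₀ = 0]} h^{[x₁ = -1 ∧ z₁ = 0]}` transforms the closure configuration
`ω_{g,h}` into one that is trivial on the four inner bonds of the block (`2 ≤ L`).
[cite: SchuchCiracPerezGarcia2010, Thm. 5.7] -/
theorem closureGauge_trivial_on_block {L : ℕ} [NeZero L] (hL : 2 ≤ L) {G : Type*} [Group G]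
    (g h : G) (hgh : g * h = h * g) (x : TorusSite 2 L) (i c : Fin 2) :
    (fun z : TorusSite 2 L => (if x 0 = -1 ∧ z 0 = 0 then g else 1) * (if x 1 = -1 ∧ z 1 = 0 then h else 1))
        (torusBlockSite L 2 2 x (![((0 : Fin 2), c), (c, 0)] i)) *
      (if (torusBlockSite L 2 2 x (![((0 : Fin 2), c), (c, 0)] i)) i = -1 then (![g, h] : Fin 2 → G) i
        else 1) *
      ((fun z : TorusSite 2 L => (if x 0 = -1 ∧ z 0 = 0 then g else 1) * (if x 1 = -1 ∧ z 1 = 0 then h else 1))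
        (torusBlockSite L 2 2 x (![((0 : Fin 2), c), (c, 0)] i) + torusUnit L i))⁻¹ = 1 := by
  haveI : Nontrivial (ZMod L) := ZMod.nontrivial_iff.2 (by omega)
  have hm1 : ((-1 : ZMod L) = 0) = False := propext ⟨fun h => neg_ne_zero.2 one_ne_zero h, False.elim⟩
  have hm1' : ((-1 : ZMod L) + 1 = 0) = True := propext ⟨fun _ => trivial, fun _ => neg_add_cancel 1⟩
  have hc0 : ∀ j : Fin 2, torusBlockSite L 2 2 x (0, c) j = x j + (![(0 : ZMod L), ((c : ℕ) : ZMod L)]) j := by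
    intro j
    fin_cases j <;> simp [torusBlockSite]
  have hc1 : ∀ j : Fin 2, torusBlockSite L 2 2 x (c, 0) j = x j + (![((c : ℕ) : ZMod L), (0 : ZMod L)]) j := by
    intro j
    fin_cases j <;> simp [torusBlockSite]
  have hu : ∀ (z : TorusSite 2 L) (i j : Fin 2), (z + torusUnit L i) j = z j + (if j = i then 1 else 0) := by
    intro z i j
    simp [torusUnit, Pi.single_apply]
  fin_cases i
  · simp only [Fin.zero_eta, Fin.isValue, Matrix.cons_val_zero, hu, hc0, Matrix.cons_val_one,
      Matrix.cons_val_fin_one, add_zero, if_true, one_ne_zero, if_false]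
    have hA : ¬ (x 0 = -1 ∧ x 0 = 0) := fun hh => by
      rw [hh.1] at hh
      exact absurd hh.2 (by rw [hm1]; exact id)
    by_cases hd : x 0 = -1
    · have hB : x 0 = -1 ∧ x 0 + 1 = 0 := ⟨hd, by rw [hd, neg_add_cancel]⟩
      by_cases he : x 1 = -1 ∧ x 1 + ((c : ℕ) : ZMod L) = 0
      · simp only [if_neg hA, if_pos he, if_pos hd, if_pos hB, one_mul]
        rw [hgh, mul_inv_cancel]
      · simp only [if_neg hA, if_neg he, if_pos hd, if_pos hB, one_mul, mul_one]
        exact mul_inv_cancel _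
    · have hB : ¬ (x 0 = -1 ∧ x 0 + 1 = 0) := fun hh => hd hh.1
      simp only [if_neg hA, if_neg hd, if_neg hB, one_mul, mul_one]
      exact mul_inv_cancel _
  · simp only [Fin.mk_one, Fin.isValue, Matrix.cons_val_one, Matrix.cons_val_fin_one, hu, hc1,
      Matrix.cons_val_zero, add_zero, if_true, zero_ne_one, if_false]
    have hA : ¬ (x 1 = -1 ∧ x 1 = 0) := fun hh => by
      rw [hh.1] at hh
      exact absurd hh.2 (by rw [hm1]; exact id)
    by_cases he : x 1 = -1
    · have hB : x 1 = -1 ∧ x 1 + 1 = 0 := ⟨he, by rw [he, neg_add_cancel]⟩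
      simp only [if_neg hA, if_pos he, if_pos hB, mul_one]
      exact mul_inv_cancel _
    · have hB : ¬ (x 1 = -1 ∧ x 1 + 1 = 0) := fun hh => he hh.1
      simp only [if_neg hA, if_neg he, if_neg hB, mul_one]
      exact mul_inv_cancel _


/-- **Frustration-freeness of the `(g,h)`-closed PEPS** (the inclusion "⊇" of
Schuch–Cirac–Pérez-García (2010) Thm. 5.7): for a `G`-invariant tensor and a commuting pair
`(g, h)`, the parent Hamiltonian annihilates `|Ψ(A | (g,h))⟩` (`2 ≤ L`). Proof: `|Ψ(A|(g,h))⟩ =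
𝒫^{⊗Λ}(Ω_{g,h})` (`pepsTorusTwisted_eq_sum_legs`, `prod_seamWeight_eq_bondTensor`); for the block at
`x`, a gauge transformation moves both loops off the block (`closureGauge_trivial_on_block`,
`gauge_bondTensor`) without changing the state (`virtualP_gauge`); the transformed bond tensor is
`δ` on the inner bonds of the block (`bondTensor_mem_bondSpace`), so the slices along the block are
block states (`exists_pepsRect_slice_virtualP`) and `h_x` kills the state
(`localOp_torusBlock_mulVec_eq_zero`). [cite: SchuchCiracPerezGarcia2010, Thm. 5.7] -/
theorem pepsParentHamiltonian_mulVec_pepsTorusTwisted (L : ℕ) [NeZero L] (hL : 2 ≤ L)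
    {G : Type*} [Group G] (U : G →* Matrix.unitaryGroup (Fin D) ℂ) {A : PEPSTensor q D}
    (hA : ∀ (k : G) (s : Fin q), legAct (U k : Matrix.unitaryGroup (Fin D) ℂ) (A s) = A s)
    (g h : G) (hgh : g * h = h * g) :
    pepsParentHamiltonian L 2 2 A *ᵥ
      pepsTorusTwisted L A ((U g : Matrix.unitaryGroup (Fin D) ℂ) : Matrix (Fin D) (Fin D) ℂ)
        ((U h : Matrix.unitaryGroup (Fin D) ℂ) : Matrix (Fin D) (Fin D) ℂ) = 0 := by
  classical
  unfold pepsParentHamiltonian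
  rw [Matrix.sum_mulVec]
  refine Finset.sum_eq_zero fun x _ => localOp_torusBlock_mulVec_eq_zero L hL A x _ fun σ => ?_
  -- the inner bonds of the block at `x`
  set Sx : Finset (TorusSite 2 L × Fin 2) :=
    (Finset.univ : Finset (Fin 2 × Fin 2)).image fun ic =>
      (torusBlockSite L 2 2 x (![((0 : Fin 2), ic.2), (ic.2, 0)] ic.1), ic.1) with hSx_def
  have hSx : ∀ b : TorusSite 2 L × Fin 2, b ∈ Sx ↔
      ∃ i c : Fin 2, b = (torusBlockSite L 2 2 x (![((0 : Fin 2), c), (c, 0)] i), i) := by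
    intro b
    simp only [hSx_def, Finset.mem_image, Finset.mem_univ, true_and, Prod.exists]
    exact ⟨fun ⟨i, c, h⟩ => ⟨i, c, h.symm⟩, fun ⟨i, c, h⟩ => ⟨i, c, h.symm⟩⟩
  -- the gauge transformation moving the loops off the block, and the transformed configuration
  obtain ⟨γ, hγ⟩ : ∃ γ : TorusSite 2 L → G, γ = fun z =>
      (if x 0 = -1 ∧ z 0 = 0 then g else 1) * (if x 1 = -1 ∧ z 1 = 0 then h else 1) := ⟨_, rfl⟩
  have hκ : ∀ b ∈ Sx, γ b.1 * (if b.1 b.2 = -1 then (![g, h] : Fin 2 → G) b.2 else 1) *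
      (γ (b.1 + torusUnit L b.2))⁻¹ = 1 := by
    intro b hb
    obtain ⟨i, c, rfl⟩ := (hSx b).1 hb
    rw [hγ]
    exact closureGauge_trivial_on_block hL g h hgh x i c
  obtain ⟨h1, h2⟩ := bondTensor_mem_bondSpace U
    (fun b => γ b.1 * (if b.1 b.2 = -1 then (![g, h] : Fin 2 → G) b.2 else 1) *
      (γ (b.1 + torusUnit L b.2))⁻¹) Sx hκ
  obtain ⟨X, hX⟩ := exists_pepsRect_slice_virtualP L hL A x hSx _ h1 h2 σ
  refine ⟨X, fun β => ?_⟩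
  rw [← hX β, pepsTorusTwisted_eq_sum_legs]
  simp only [prod_seamWeight_eq_bondTensor]
  simp only [← gauge_closureTensor U γ g h]
  exact (virtualP_gauge U hA γ _ _).symm

/-- **Discharge of `pepsParent_groundSpace_of_GInjective` — the parent Hamiltonian theorem for
`G`-injective PEPS** (Schuch–Cirac–Pérez-García (2010) Thm. 5.7): for a semi-regular unitary
representation `U` of the finite group `G`, a `G`-injective tensor `A` and `2 ≤ L`, the zero-energy
space of `H = Σ_x (1 - Π_{𝒮_{2×2}})_x` on the `L × L` torus is spanned by the `(g,h)`-closed PEPS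
with `gh = hg`. Proof, at the virtual level: let `T` be the `G`-injective left inverse
(`exists_leg_leftInverse_G`, Def. 5.1 (ii): `T 𝒫 = Π_𝒰`). (⊆) If `H ψ = 0`, every `2 × 2` block
slice of `ψ` is a block state (null space of a sum of projectors = intersection), so
`Φ = T^{⊗Λ} ψ` is in local gauge form at every plaquette (`virtualT_localGaugeForm`, Lemma 5.2 /
Thm. 5.4) and hence a combination of **flat** bond tensors `⊗_b U_{κ_b}`
(`virtualT_bondExpansion`, semi-regularity); a flat `κ` is a gauge transform of a closure
configuration `ω_{g,h}` with `gh = hg` (`exists_gauge_of_flat`, Thm. 5.5), so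
`𝒫^{⊗Λ}(⊗_b U_{κ_b}) = 𝒫^{⊗Λ}(Ω_{g,h}) = |Ψ(A|(g,h))⟩` by gauge invariance (`virtualP_gauge`,
`gauge_bondTensor`); and `ψ = 𝒫^{⊗Λ} T^{⊗Λ} ψ` (`π = 𝒫 T` fixes `ψ` sitewise). (⊇)
`pepsParentHamiltonian_mulVec_pepsTorusTwisted`. Degenerate `q = 0`: the Hilbert space is `0`.
[cite: SchuchCiracPerezGarcia2010, Thm. 5.7] -/
theorem pepsParent_groundSpace_of_GInjective_holds : pepsParent_groundSpace_of_GInjective := by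
  intro q D G _ _ U A hU hG L _ hL ψ
  classical
  -- degenerate local dimension `q = 0`: there are no configurations
  rcases Nat.eq_zero_or_pos q with rfl | hq
  · haveI : IsEmpty (TensorIndex (TorusSite 2 L) 0) := ⟨fun σ => Fin.elim0 (σ 0)⟩
    have hψ : ψ = 0 := funext fun σ => isEmptyElim σ
    exact ⟨fun _ => by rw [hψ]; exact Submodule.zero_mem _, fun _ => funext fun σ => isEmptyElim σ⟩
  have hA := hG.1
  obtain ⟨t, ht⟩ := exists_leg_leftInverse_G U hG
  constructor
  · intro h0
    have hslice := exists_boundary_of_pepsParentHamiltonian_mulVec_eq_zero L hL A ψ h0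
    obtain ⟨c, hc0, hc⟩ := virtualT_bondExpansion L hL hq U hU A t ht ψ hslice
    -- `ψ = 𝒫^{⊗Λ} T^{⊗Λ} ψ`
    have hπ := sum_pi_mul_A_of_leftInverse_G U hA t ht
    have hfixψ : ∀ σ : TensorIndex (TorusSite 2 L) q, ψ σ =
        ∑ G₁ : TorusSite 2 L → Fin 2 → Fin 2 → Fin D,
          (∏ y, A (σ y) (G₁ y 0 0) (G₁ y 1 0) (G₁ y 0 1) (G₁ y 1 1)) *
            ∑ τ : TensorIndex (TorusSite 2 L) q, (∏ y, t (G₁ y) (τ y)) * ψ τ := by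
      intro σ
      have hfix := sum_prod_mul_eq_self_of_forall_update
        (fun s s' => ∑ g' : Fin 2 → Fin 2 → Fin D, A s (g' 0 0) (g' 1 0) (g' 0 1) (g' 1 1) * t g' s') ψ
        (fun y τ => sum_pi_update_eq_self_of_slices' L hL A _ hπ ψ hslice y τ) σ
      rw [← hfix, ← virtual_rightComp_apply A t ψ σ]
    -- the expansion in flat bond tensors
    have hψeq : ψ = ∑ κ : TorusSite 2 L × Fin 2 → G, c κ •
        fun σ : TensorIndex (TorusSite 2 L) q => ∑ G₁ : TorusSite 2 L → Fin 2 → Fin 2 → Fin D,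
          (∏ y, A (σ y) (G₁ y 0 0) (G₁ y 1 0) (G₁ y 0 1) (G₁ y 1 1)) *
            ∏ b : TorusSite 2 L × Fin 2,
              ((U (κ b) : Matrix.unitaryGroup (Fin D) ℂ) : Matrix (Fin D) (Fin D) ℂ)
                (G₁ b.1 b.2 1) (G₁ (b.1 + torusUnit L b.2) b.2 0) := by
      funext σ
      rw [hfixψ σ]
      simp only [hc, Finset.sum_apply, Pi.smul_apply, smul_eq_mul, Finset.mul_sum]
      rw [Finset.sum_comm]
      refine Finset.sum_congr rfl fun κ _ => Finset.sum_congr rfl fun G₁ _ => ?_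
      ring
    rw [hψeq]
    refine Submodule.sum_mem _ fun κ _ => ?_
    by_cases hflat : ∀ x : TorusSite 2 L,
        κ (x, 0) * κ (x + torusUnit L 0, 1) = κ (x, 1) * κ (x + torusUnit L 1, 0)
    · -- a flat configuration is a gauge transform of a closure
      obtain ⟨γ, g, h, hgh, hκ⟩ := exists_gauge_of_flat κ hflat
      refine Submodule.smul_mem _ _ (Submodule.subset_span ⟨g, h, hgh, ?_⟩)
      funext σ
      have hκ' : ∀ b : TorusSite 2 L × Fin 2, κ b =
          γ b.1 * (if b.1 b.2 = -1 then (![g, h] : Fin 2 → G) b.2 else 1) *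
            (γ (b.1 + torusUnit L b.2))⁻¹ := fun b => hκ b.1 b.2
      rw [pepsTorusTwisted_eq_sum_legs]
      simp only [prod_seamWeight_eq_bondTensor, hκ']
      simp only [← gauge_closureTensor U γ g h]
      exact virtualP_gauge U hA γ _ _
    · push Not at hflat
      obtain ⟨x, hx⟩ := hflat
      rw [hc0 κ ⟨x, hx⟩, zero_smul]
      exact Submodule.zero_mem _
  · intro hmem
    have hker : {φ : TensorIndex (TorusSite 2 L) q → ℂ | ∃ g h : G, g * h = h * g ∧
        φ = pepsTorusTwisted L A ((U g : Matrix.unitaryGroup (Fin D) ℂ) : Matrix (Fin D) (Fin D) ℂ)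
          ((U h : Matrix.unitaryGroup (Fin D) ℂ) : Matrix (Fin D) (Fin D) ℂ)} ⊆
        (LinearMap.ker (Matrix.mulVecLin (pepsParentHamiltonian L 2 2 A)) :
          Submodule ℂ (TensorIndex (TorusSite 2 L) q → ℂ)) := by
      rintro φ ⟨g, h, hgh, rfl⟩
      rw [SetLike.mem_coe, LinearMap.mem_ker, Matrix.mulVecLin_apply]
      exact pepsParentHamiltonian_mulVec_pepsTorusTwisted L hL U hA g h hgh
    have h := Submodule.span_le.2 hker hmem
    rw [LinearMap.mem_ker, Matrix.mulVecLin_apply] at h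
    exact h

end QLattice
end Literature.MathematicalPhysics.QuantumLattice
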